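import Summits.ResolutionOfSingularities.ResolutionOfSingularities.Theses.CleanCovers
import Literature.AlgebraicGeometry.Resolution.NonReducedNoResolution
import Literature.AlgebraicGeometry.Resolution.PrincipalizationToResolution
import Literature.AlgebraicGeometry.Resolution.ProjectiveSpaceRegular
import Literature.AlgebraicGeometry.Motives.ProjectiveSpaceFieldPoints
import Literature.AlgebraicGeometry.Motives.VarietiesProperProofs
import Literature.AlgebraicGeometry.Motives.SmoothOverRegularBase
import Literature.AlgebraicGeometry.Resolution.LogRegularSchemeEtale
import Literature.AlgebraicGeometry.Resolution.ResolutionGlue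
import Literature.AlgebraicGeometry.Resolution.LogRegularNormal
import Mathlib.AlgebraicGeometry.Morphisms.Flat
import Mathlib.RingTheory.Flat.FaithfullyFlat.Algebra

/-!
# Disproof work file — crux `CleanCovers.CoverResolution` (stmt-ResolutionOfSingularities-15104)

Standing disprover (`cdisprove`, cycle 1 and cycle 2 = line `strategy-split`, 2026-08-17; §8 is the
line section). The crux: for every prime `p`, perfect field
`k` of characteristic `p`, `n`, every INTEGRAL `X` and FINITE SURJECTIVE `f : X → ℙⁿ_k` that is
ÉTALE over the chart `D₊(xₙ) ≅ 𝔸ⁿ_k`, `X` has a resolution (`Scheme.HasResolution`: proper,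
birational = iso over a dense open with dense preimage, regular source).

## Findings (index; every claim below is a checked declaration of this file unless marked PAPER)

1. **No kill, and none is possible short of ¬summit.** `coverResolution_of_stripped` +
   `stripped_of_resolutionOfSingularities`: the summit implies the crux with `PerfectField`,
   `Etale`, `Surjective` DELETED and `IsIntegral` weakened to `IsReduced`; conversely (rattack seat,
   evidence `Equivalence.lean` on the item, tree `Kedlaya2004_finite_etale_off_hyperplane_holds`)
   the crux gives the summit over perfect fields. So `¬ CoverResolution` is `¬` resolution over
   some perfect field: a PROBLEM DECIDER, not a route-local event. Known TRUE for `n ≤ 3`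
   (`n = 0` here: `coverResolution_dim_zero`; `n ≤ 1` curves, tree `hasResolution_of_dim_le_one`;
   `n ≤ 3` modulo the named fact `CossartPiltant2019`); open content starts at `n = 4`. There is no
   finite / decidable instance (no `decide`, no `kit` falsifier): every instance quantifies over a
   scheme.
2. **Load-bearing hypotheses (Lean).** `IsIntegral X`: FALSE without it —
   `coverResolution_false_without_isIntegral`, witness `X = ℙ¹_{𝔽₂} ⨿ Spec 𝔽₂[ε]` mapping by
   `𝟙 ⨿ [1:0]` (finite, surjective, an open immersion over `D₊(x₁)`; no resolution because the open
   summand `Spec 𝔽₂[ε]` has none). Exactly its REDUCEDNESS part is used: modulo the summit the crux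
   holds for REDUCED, possibly reducible `X` (`stripped_of_resolutionOfSingularities`), so
   irreducibility is never needed — a prover may normalise component by component.
3. **Decoration (Lean).** `p.Prime`: removable modulo `Hironaka1964` —
   `coverResolution_without_prime_of_hironaka` (a field of characteristic `p` has `p` prime or
   `0`). `PerfectField k`, `Etale (f ∣_ D₊(xₙ))`, `Surjective f.base`: removable modulo the summit
   (item 1) — they are the Kedlaya NORMAL FORM, i.e. what a proof is INVITED to use, not what it is
   forced to use; a proof that never uses étaleness over the chart is a proof of the projective
   summit over `k`.
4. **`IsFinite f` is load-bearing (Lean, `n = 2`): `coverResolution_false_without_isFinite`.**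
   Witness (§4, namespace `PinchWitness`): in the chart `D₊(x₀) = Spec k[y₀,y₁]` (`y₀ = x₁/x₀`,
   `y₁ = x₂/x₀`, so `H = V₊(x₂)` is `y₁ = 0`), let `A = k[y₀,y₁,y₁⁻¹]` and
   `O := {a ∈ A : a(0, y₁) ∈ k[y₀,y₁]} = k[y₁] + y₀·A` (the PINCH RING: a non-Noetherian domain with
   `O[1/y₁] = A`, in which `u = y₀ ≠ 0` is divisible by every power of the non-unit `v = y₁`);
   glue `X := ℙ²_k ∪ Spec O` along the open immersions `Spec A = D₊(x₀x₂) ↪ ℙ²_k`,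
   `Spec A = D(v) ↪ Spec O` (Mathlib's pushout of a span of open immersions). Then `X` is integral,
   `f = 𝟙 ∪ (Spec O → D₊(x₀))` is surjective and an OPEN IMMERSION over `D₊(x₂)` (a point of
   `Spec O` over `D₊(x₂)` has `v ∉ 𝔭`, i.e. lies in `D(v) = Spec A ⊆ ℙ²_k`), yet `X` has no
   resolution, by the affine core `not_hasResolution_Spec_of_forall_pow_dvd`: for a proper
   `π : X' → Spec O` that is an isomorphism over a dense open `U ∋ η` with `X'` regular STALKWISE
   (no local Noetherianity of `X'` is needed), let `η'` be the point over the generic point `η`;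
   `π` is closed, so some `x' ∈ cl(η')` maps to a maximal ideal `𝔪 ∋ v`; `B = 𝒪_{X',x'}` is a
   regular, hence Noetherian, local domain; `O → B` is local, and injective because after
   generization to `η'` it is `O ↪ O_{(0)} → 𝒪_{X',η'}` with `π.stalkMap η'` an isomorphism; so
   `u ∈ ⋂ₙ vⁿB ⊆ ⋂ₙ 𝔪_Bⁿ = 0` (Krull) contradicts `u ≠ 0`. NOT load-bearing for `n ≤ 1` (PAPER):
   `K(X) = L` is finite separable over `k(t)` (generic fibre of the étale `f⁻¹(𝔸¹) → 𝔸¹`), every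
   affine ring `B` of `X` is a `k`-subalgebra of `L` with `Frac B = L`, hence (Krull–Akizuki over
   `k[y] ⊆ B`) Noetherian of dimension `≤ 1` with normalisation `B·R'` (`R'` = integral closure of
   `k[y]` in `L`) Dedekind and FINITE over `B`; the normalisation `X^ν → X` is then finite
   birational with regular source (`n = 0`: `X` is étale over `Spec k`). Moral for provers:
   finiteness is used only through local Noetherianity / finite type of `X` over `H`, from
   dimension `2` on.
5. **Natural strengthenings (PAPER).** (a) "`X` is already regular": FALSE — `p = 2`,
   `E : y² + y = x³` (supersingular, the double cover `E → ℙ¹_x` is étale over `𝔸¹` and totally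
   wildly ramified at `∞`); pinch the point at infinity: `X := Spec_{ℙ¹}(𝒜)` with `𝒜 = f_*𝒪_E` over
   `𝔸¹` and `𝒜_∞ = 𝒪_{ℙ¹,∞} + 𝔪_∞·(f_*𝒪_E)_∞`; `X` is an integral finite cover of `ℙ¹`, étale over
   `𝔸¹`, singular over `∞` (its resolution is `E → X`). (b) "the normalisation of `X` is regular":
   FALSE for `n ≥ 2` — normalised `p`-cyclic covers of a regular surface, branched (wildly) along
   `H` only, acquire for instance cones over plane curves of degree `p` as singularities
   (Piltant 2003, doi:10.5802/aif.1978, Example 3.4 (2), the example the route opener read on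
   pp. 1237–1242: not regular, not even toric before further blow-ups of the base). (c) imperfect
   `k`: NOT a strengthening that can be refuted — still a consequence of the summit (item 1).
   None of (a)–(b) is formalised (no finite covers beyond `𝟙 ⨿ pt` are constructible cheaply:
   Mathlib has no relative `Spec`, and `Proj` functoriality only for degree-preserving maps).
6. **Barriers / negatives.** `ledger negatives`: none on this decl. The catalogue entries
   (`chevalley_barrier`, `Cutkosky2014`/`LocalMonomializationFails*`, `DimensionFourFrontier`,
   `BaseOnlyRadicialNormalizationCannot`) constrain MECHANISMS (Jung/monomialisation/base-only
   cleaning), not this existence statement; `BaseOnlyRadicialNormalizationCannot` concerns RADICIAL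
   covers, which the Kedlaya normal form excludes by construction (separable, étale over `𝔸ⁿ`).
7. **Why it resists (for the provers).** The statement is resolution over perfect fields in Kedlaya
   costume; every cheap attack either lands in the known range (`n ≤ 3`) or would refute the
   summit. The only hypotheses a proof is FORCED to use are reducedness of `X` over `H` and
   finite-type-ness of `X` over `H`; everything else is an offer. Do not staff the crux itself —
   its content is in the split children (`Cruxes/CoverResolution/SPLIT.md`).
8. **Line `strategy-split` (cycle 2, §8).** The stubs P1 `BoundaryLogRegularization` / P3
   `LogRegularPatching` are CONSEQUENCES of the crux (landed converses, p160676) — irrefutable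
   short of ¬summit, like the crux; P2 `LogRegularResolution` ↔ the named fact
   `Niziol2006_logRegularScheme_hasResolution` (Nizioł 2006 Cor. 5.7), whose interface
   (`EtaleLogAtlas.IsLogRegular`) I read for junk models and found faithful (the dimension clause
   of Kato's (2.1) excludes fat points; compatibility over all ordered pairs of charts). Joint
   sufficiency is the landed assembly (p160185): no gap. Load-bearing in P1 (Lean):
   `boundaryLogRegularization_false_without_isFinite` — P1 minus `IsFinite f` is FALSE (pinch
   cover, `h` = image of the pinch point), via the sharpened core `no_noetherianModel_near_pinch`:
   over an open of `Spec O` meeting the pinch there is no proper birational model with even a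
   LOCALLY NOETHERIAN source, so "∃ B ∋ h" and "log regular instead of regular" buy nothing.
   `IsIntegral` load-bearing in P1 modulo the named fact Kato (4.1) (Lean, §8b:
   `boundaryLogRegularization_false_without_isIntegral_of_kato1994`, via
   `isDomain_stalk_of_isLogRegularEtale`); `Perfect/Etale/Surjective/p.Prime` decoration in P1
   and P3; P3's own hypotheses are not reachable by local bad-point witnesses
   (its content is the overlap). No `-- Targets` (lead's STUCK list empty; verdict promote-stub).

Landed / proposed from this file (def-free Negative/ forms): `Theorems/CoverResolution/Negative/LoadBearing.lean`
(`coverResolution_false_without_isIntegral`, `coverResolution_stripped_of_resolutionOfSingularities`,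
`coverResolution_without_prime_of_hironaka`; p156231), `Theorems/CoverResolution/Negative/FalseWithoutIsFiniteTools.lean`
(`not_hasResolution_Spec_of_forall_pow_dvd`, `exists_glued_of_not_hasResolution`; p156244 ACCEPTED
c680d8923c6d) and `Theorems/CoverResolution/Negative/FalseWithoutIsFinite.lean` (the pinch witness,
`coverResolution_false_without_isFinite`; p157152 ACCEPTED bb96cdd4a4f0) and, cycle 2,
`Theorems/CoverResolution/Negative/BoundaryLogRegularizationFalseWithoutIsFinite.lean`
(`no_noetherianModel_near_pinch`, `exists_glued_with_piece`, `exists_noetherianModel_of_isOpenImmersion`,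
`pinch_no_noetherianModel_over_open`, `boundaryLogRegularization_false_without_isFinite`; p162912),
`Theorems/CoverResolution/Negative/BoundaryLogRegularizationFalseWithoutIsIntegral.lean`
(`isDomain_stalk_of_isLogRegularEtale`, `not_isDomain_stalk_spec_dualNumber`,
`boundaryLogRegularization_false_without_isIntegral_of_kato1994`; p163441).
-/

noncomputable section

set_option linter.dupNamespace false

open CategoryTheory CategoryTheory.Limits AlgebraicGeometry
open Literature.AlgebraicGeometry.Resolution Literature.AlgebraicGeometry.Motives
open Summit.ResolutionOfSingularities.ResolutionOfSingularities.Theses.CleanCovers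

namespace Summit.ResolutionOfSingularities.ResolutionOfSingularities.Cruxes.CoverResolution.Disproof

/-! ## 0. Variants of the crux (hypotheses dropped / weakened), as `Prop`s -/

/-- The crux with `PerfectField`, `Etale`, `Surjective` deleted and `IsIntegral X` weakened to
`IsReduced X` ("stripped" form): every reduced scheme finite over some `ℙⁿ_k`, `k` any field of
prime characteristic `p`, has a resolution. [folklore] -/
def Stripped : Prop :=
  ∀ p : ℕ, p.Prime → ∀ (k : Type) [Field k] [CharP k p] (n : ℕ) (X : Scheme.{0})
    (f : X ⟶ (projectiveSpace n k).left), IsReduced X → IsFinite f → Scheme.HasResolution X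

/-- The crux with `IsIntegral X` deleted (everything else verbatim). [folklore] -/
def WithoutIsIntegral : Prop :=
  ∀ p : ℕ, p.Prime → ∀ (k : Type) [Field k] [CharP k p] [PerfectField k] (n : ℕ)
    (X : AlgebraicGeometry.Scheme.{0})
    (f : X ⟶ (Literature.AlgebraicGeometry.Motives.projectiveSpace n k).left),
    AlgebraicGeometry.IsFinite f → Function.Surjective f.base →
    (letI := MvPolynomial.gradedAlgebra (σ := Fin (n + 1)) (R := k);
      AlgebraicGeometry.Etale (f ∣_ (AlgebraicGeometry.Proj.basicOpen
        (MvPolynomial.homogeneousSubmodule (Fin (n + 1)) k) (MvPolynomial.X (Fin.last n))))) →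
    Literature.AlgebraicGeometry.Resolution.Scheme.HasResolution X

/-- The crux with `IsFinite f` deleted (everything else verbatim). [folklore] -/
def WithoutIsFinite : Prop :=
  ∀ p : ℕ, p.Prime → ∀ (k : Type) [Field k] [CharP k p] [PerfectField k] (n : ℕ)
    (X : AlgebraicGeometry.Scheme.{0})
    (f : X ⟶ (Literature.AlgebraicGeometry.Motives.projectiveSpace n k).left),
    AlgebraicGeometry.IsIntegral X → Function.Surjective f.base →
    (letI := MvPolynomial.gradedAlgebra (σ := Fin (n + 1)) (R := k);
      AlgebraicGeometry.Etale (f ∣_ (AlgebraicGeometry.Proj.basicOpen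
        (MvPolynomial.homogeneousSubmodule (Fin (n + 1)) k) (MvPolynomial.X (Fin.last n))))) →
    Literature.AlgebraicGeometry.Resolution.Scheme.HasResolution X

/-- The crux with the primality hypothesis on `p` deleted (so `p = 0`, characteristic zero, is
allowed; `CharP k p` for a field forces `p` prime or `0`). [folklore] -/
def WithoutPrime : Prop :=
  ∀ p : ℕ, ∀ (k : Type) [Field k] [CharP k p] [PerfectField k] (n : ℕ)
    (X : AlgebraicGeometry.Scheme.{0})
    (f : X ⟶ (Literature.AlgebraicGeometry.Motives.projectiveSpace n k).left),
    AlgebraicGeometry.IsIntegral X → AlgebraicGeometry.IsFinite f → Function.Surjective f.base →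
    (letI := MvPolynomial.gradedAlgebra (σ := Fin (n + 1)) (R := k);
      AlgebraicGeometry.Etale (f ∣_ (AlgebraicGeometry.Proj.basicOpen
        (MvPolynomial.homogeneousSubmodule (Fin (n + 1)) k) (MvPolynomial.X (Fin.last n))))) →
    Literature.AlgebraicGeometry.Resolution.Scheme.HasResolution X

/-! ## 1. Position relative to the summit: which hypotheses are mere decoration -/

/-- The stripped form trivially implies the crux (integral ⇒ reduced; the other deleted hypotheses
are simply not used). [folklore] -/
theorem coverResolution_of_stripped (h : Stripped) : CoverResolution := by
  intro p hp k _ _ _ n X f hint hfin _ _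
  exact h p hp k n X f inferInstance hfin

/-- **The summit implies the stripped crux**: a reduced scheme finite over `ℙⁿ_k` is separated, of
finite type and quasi-compact over `k` (finite ⇒ affine ⇒ separated, quasi-compact, locally of
finite type; `ℙⁿ_k → Spec k` is proper), so `ResolutionInChar p` applies. Consequently
`PerfectField`, étaleness over the chart, surjectivity and irreducibility are NOT load-bearing for
the truth of the crux — only for its role as a normal form. [folklore] -/
theorem stripped_of_resolutionOfSingularities (hS : _root_.ResolutionOfSingularities) :
    Stripped := by
  intro p hp k _ _ n X f hred hfin
  haveI := hfin
  haveI : IsProper (projectiveSpace n k).hom := isProper_projectiveSpace n k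
  let g : X ⟶ Spec (.of k) := f ≫ (projectiveSpace n k).hom
  haveI : IsSeparated g := inferInstanceAs (IsSeparated (f ≫ (projectiveSpace n k).hom))
  haveI : LocallyOfFiniteType g :=
    inferInstanceAs (LocallyOfFiniteType (f ≫ (projectiveSpace n k).hom))
  haveI : QuasiCompact g := inferInstanceAs (QuasiCompact (f ≫ (projectiveSpace n k).hom))
  exact hS p hp k X g inferInstance inferInstance inferInstance hred

/-- Hence the summit implies the crux (the crux is a CONSEQUENCE of the summit; with Kedlaya 2004
Thm. 1 it is equivalent to the summit over perfect fields). [folklore] -/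
theorem coverResolution_of_resolutionOfSingularities (hS : _root_.ResolutionOfSingularities) :
    CoverResolution :=
  coverResolution_of_stripped (stripped_of_resolutionOfSingularities hS)

/-- **`p.Prime` is decoration modulo Hironaka.** For a field `k` with `CharP k p`, `p` is prime or
`0`; the prime case is the crux, the case `p = 0` is Hironaka's theorem (named fact
`Hironaka1964`, here a hypothesis). [folklore] -/
theorem coverResolution_without_prime_of_hironaka (hH : Hironaka1964.{0}) (hC : CoverResolution) :
    WithoutPrime := by
  intro p k _ _ _ n X f hint hfin hsurj het
  rcases CharP.char_is_prime_or_zero k p with hp | hp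
  · exact hC p hp k n X f hint hfin hsurj het
  · subst hp
    haveI := hfin
    haveI : IsProper (projectiveSpace n k).hom := isProper_projectiveSpace n k
    let g : X ⟶ Spec (.of k) := f ≫ (projectiveSpace n k).hom
    haveI : IsSeparated g := inferInstanceAs (IsSeparated (f ≫ (projectiveSpace n k).hom))
    haveI : LocallyOfFiniteType g :=
      inferInstanceAs (LocallyOfFiniteType (f ≫ (projectiveSpace n k).hom))
    haveI : QuasiCompact g := inferInstanceAs (QuasiCompact (f ≫ (projectiveSpace n k).hom))
    exact hH k X g inferInstance inferInstance inferInstance inferInstance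

/-! ## 2. `IsIntegral X` is load-bearing (its reducedness part) -/

/-- A `k`-rational point of `ℙⁿ_k` is a closed immersion `Spec k → ℙⁿ_k` (a section of the separated
structure morphism; Mathlib `isClosedImmersion_of_comp_eq_id`). [folklore] -/
theorem isClosedImmersion_left_of_algPoints (k : Type) [Field k] (n : ℕ)
    (P : AlgPoints (projectiveSpace n k) k) : IsClosedImmersion P.left := by
  haveI : Subsingleton ↥(Spec (CommRingCat.of k)) :=
    inferInstanceAs (Subsingleton (PrimeSpectrum k))
  have h := Over.w P
  have h2 : (specOver k k).hom = 𝟙 (Spec (.of k)) := by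
    change Spec.map (CommRingCat.ofHom (algebraMap k k)) = 𝟙 _
    rw [Algebra.algebraMap_self, CommRingCat.ofHom_id]; exact Spec.map_id _
  exact isClosedImmersion_of_comp_eq_id (Y := Spec (.of k)) (projectiveSpace n k).hom P.left
    (h.trans h2)

/-- **`IsIntegral X` is load-bearing: the crux without it is FALSE.** Witness `p = 2`, `k = 𝔽₂`,
`n = 1`, `X = ℙ¹_k ⨿ Spec k[ε]`, `f = 𝟙 ⨿ (Spec k[ε] → Spec k = [1 : 0] ↪ ℙ¹_k)`: `f` is finite
(identity ⨿ (finite ≫ closed immersion)), surjective (identity summand) and an OPEN IMMERSION —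
a fortiori étale — over `D₊(x₁)`, since the fat point sits over `[1 : 0] ∈ V₊(x₁)` so that
`f⁻¹(D₊(x₁)) ↪ X` factors through the summand `ℙ¹` on which `f` is the identity; and `X` has no
resolution, because a resolution restricts along the open immersion `Spec k[ε] ↪ X`
(`Scheme.HasResolution.of_isOpenImmersion`) while `Spec k[ε]` has none
(`not_hasResolution_spec_dualNumber`). Any proof of the crux must therefore use reducedness of `X`
at the generic points of `f⁻¹(H)`; by §1 it need not use irreducibility. [folklore] -/
theorem coverResolution_false_without_isIntegral : ¬ WithoutIsIntegral := by
  intro h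
  letI := MvPolynomial.gradedAlgebra (σ := Fin (1 + 1)) (R := ZMod 2)
  let P : Scheme.{0} := (projectiveSpace 1 (ZMod 2)).left
  let T : Scheme.{0} := Spec (.of (DualNumber (ZMod 2)))
  let z : Fin (1 + 1) → ZMod 2 := Pi.single 0 1
  have hz : z ≠ 0 := by
    intro h0; have := congrFun h0 0; simp [z] at this
  let Pv := ProjectiveSpace.pointOfVec (n := 1) (ZMod 2) z hz
  let φ : T ⟶ (specOver (ZMod 2) (ZMod 2)).left :=
    Spec.map (CommRingCat.ofHom (algebraMap (ZMod 2) (DualNumber (ZMod 2))))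
  let g : T ⟶ P := φ ≫ Pv.left
  let W : P.Opens :=
    Proj.basicOpen (MvPolynomial.homogeneousSubmodule (Fin (1 + 1)) (ZMod 2)) (MvPolynomial.X (Fin.last 1))
  have hPvW : Pv.pt ∉ W := by
    show Pv.pt ∉ Proj.basicOpen _ (MvPolynomial.X (Fin.last 1))
    rw [ProjectiveSpace.pt_pointOfVec_mem_basicOpen_X_iff z hz (Fin.last 1)]
    simp [z]
  have hg : ∀ t : T, g.base t ∉ W := by
    intro t
    have ht : g.base t = Pv.pt := by
      show Pv.left.base (φ.base t) = Pv.left.base (IsLocalRing.closedPoint (ZMod 2))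
      haveI : Subsingleton ↥(specOver (ZMod 2) (ZMod 2)).left :=
        inferInstanceAs (Subsingleton (PrimeSpectrum (ZMod 2)))
      rw [Subsingleton.elim (φ.base t) (IsLocalRing.closedPoint (ZMod 2))]
    rw [ht]; exact hPvW
  let X : Scheme.{0} := P ⨿ T
  let f : X ⟶ P := coprod.desc (𝟙 P) g
  -- `f` is finite
  haveI : IsFinite φ := by
    haveI : Module.Finite (ZMod 2) (DualNumber (ZMod 2)) :=
      inferInstanceAs (Module.Finite (ZMod 2) (ZMod 2 × ZMod 2))
    show IsFinite (Spec.map _)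
    rw [IsFinite.SpecMap_iff]
    exact RingHom.finite_algebraMap.mpr inferInstance
  haveI : IsClosedImmersion Pv.left := isClosedImmersion_left_of_algPoints (ZMod 2) 1 Pv
  haveI : IsFinite g := MorphismProperty.comp_mem @IsFinite φ Pv.left ‹IsFinite φ› inferInstance
  haveI hfin : IsFinite f := inferInstance
  -- `f` is surjective (the identity summand)
  have hsurj : Function.Surjective f.base := by
    intro y
    refine ⟨(coprod.inl : P ⟶ X).base y, ?_⟩
    show ((coprod.inl : P ⟶ X) ≫ f).base y = y
    simp only [f, coprod.inl_desc]
    rfl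
  -- `f` is an open immersion (hence étale) over the chart `W = D₊(x₁)`
  have hrange : Set.range (f ⁻¹ᵁ W).ι.base ⊆ Set.range (coprod.inl : P ⟶ X).base := by
    rintro _ ⟨x, rfl⟩
    obtain ⟨y | t, hy⟩ := (coprodMk P T).surjective x.1
    · refine ⟨y, ?_⟩
      rw [← coprodMk_inl]
      exact hy
    · exfalso
      have hx : f.base x.1 ∈ W := x.2
      rw [← hy, coprodMk_inr] at hx
      apply hg t
      have e : f.base ((coprod.inr : T ⟶ X).base t) = g.base t := by
        show ((coprod.inr : T ⟶ X) ≫ f).base t = g.base t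
        simp only [f, coprod.inr_desc]
      rw [← e]
      exact hx
  let l := IsOpenImmersion.lift (coprod.inl : P ⟶ X) (f ⁻¹ᵁ W).ι hrange
  have hl : l ≫ coprod.inl = (f ⁻¹ᵁ W).ι := IsOpenImmersion.lift_fac _ _ hrange
  haveI : IsOpenImmersion l := by
    haveI : IsOpenImmersion (l ≫ (coprod.inl : P ⟶ X)) := by rw [hl]; infer_instance
    exact IsOpenImmersion.of_comp l (coprod.inl : P ⟶ X)
  have hfW : (f ∣_ W) ≫ W.ι = l := by
    rw [morphismRestrict_ι, ← hl, Category.assoc]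
    simp only [f, coprod.inl_desc, Category.comp_id]
  haveI : IsOpenImmersion (f ∣_ W) := by
    haveI : IsOpenImmersion ((f ∣_ W) ≫ W.ι) := by rw [hfW]; infer_instance
    exact IsOpenImmersion.of_comp (f ∣_ W) W.ι
  have het : Etale (f ∣_ W) := inferInstance
  -- conclude: `X` would have a resolution, hence so would its open summand `Spec k[ε]`
  have hres : Scheme.HasResolution X := h 2 Nat.prime_two (ZMod 2) 1 X f hfin hsurj het
  exact not_hasResolution_spec_dualNumber (ZMod 2)
    (Scheme.HasResolution.of_isOpenImmersion (coprod.inr : T ⟶ X) hres)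

/-! ## 3. The degenerate case `n = 0` is TRUE outright -/

/-- **`n = 0`: the crux holds** (only the étale hypothesis is used): `D₊(x₀) = ℙ⁰_k`, so `f` is
étale over the regular scheme `ℙ⁰_k`, hence `X` is regular (smooth over regular, EGA IV₄ 17.5.8)
and is its own resolution. No misstated kill hides in the bottom dimension. [folklore] -/
theorem coverResolution_dim_zero (p : ℕ) (_hp : p.Prime) (k : Type) [Field k] [CharP k p]
    [PerfectField k] (X : Scheme.{0}) (f : X ⟶ (projectiveSpace 0 k).left)
    (_hint : IsIntegral X) (_hfin : IsFinite f) (_hsurj : Function.Surjective f.base)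
    (het : letI := MvPolynomial.gradedAlgebra (σ := Fin (0 + 1)) (R := k);
      Etale (f ∣_ (Proj.basicOpen (MvPolynomial.homogeneousSubmodule (Fin (0 + 1)) k)
        (MvPolynomial.X (Fin.last 0))))) :
    Scheme.HasResolution X := by
  letI := MvPolynomial.gradedAlgebra (σ := Fin (0 + 1)) (R := k)
  set W : (projectiveSpace 0 k).left.Opens :=
    Proj.basicOpen (MvPolynomial.homogeneousSubmodule (Fin (0 + 1)) k) (MvPolynomial.X (Fin.last 0))
    with hW
  have hWtop : W = ⊤ := by
    refine top_le_iff.mp fun x _ => ?_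
    obtain ⟨y, hy⟩ := (ProjectiveSpace.chartCover 0 k).covers x
    haveI : Subsingleton (ProjectiveSpace.chartCover 0 k).I₀ :=
      inferInstanceAs (Subsingleton (Fin 1))
    have hidx : (ProjectiveSpace.chartCover 0 k).idx x = Fin.last 0 := Subsingleton.elim _ _
    have hx : x ∈ ((ProjectiveSpace.chartCover 0 k).f (Fin.last 0)).opensRange := by
      rw [← hidx]; exact ⟨y, hy⟩
    rwa [ProjectiveSpace.opensRange_chartCover_f] at hx
  haveI : Etale f :=
    IsZariskiLocalAtTarget.of_iSup_eq_top (P := @Etale) (fun _ : Unit => W)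
      (by rw [iSup_const]; exact hWtop) (fun _ => het)
  haveI : IsProper (projectiveSpace 0 k).hom := isProper_projectiveSpace 0 k
  haveI : IsLocallyNoetherian (projectiveSpace 0 k).left :=
    LocallyOfFiniteType.isLocallyNoetherian (projectiveSpace 0 k).hom
  have hreg : Scheme.IsRegular X := fun x =>
    isRegularLocalRing_stalk_of_smoothOfRelativeDimension_of_regular f 0
      (isRegular_projectiveSpace 0 k) x
  exact hreg.hasResolution

/-! ## 4. `IsFinite f` is load-bearing for `n = 2` (Lean): the pinch witness -/

namespace PinchWitness


open MvPolynomial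

variable (k : Type) [Field k]

/-- `R = k[y₀, y₁]`, the chart ring of `D₊(x₀) ⊆ ℙ²_k` (`y₀ = x₁/x₀`, `y₁ = x₂/x₀`). [folklore] -/
abbrev R : Type := MvPolynomial (Fin 2) k

/-- `A = k[y₀, y₁, y₁⁻¹]`, the ring of the open `D₊(x₀x₂)`. [folklore] -/
abbrev A : Type := Localization.Away (X 1 : MvPolynomial (Fin 2) k)

theorem X_one_ne_zero : (X 1 : R k) ≠ 0 := X_ne_zero _

theorem powers_le : Submonoid.powers (X 1 : R k) ≤ nonZeroDivisors (R k) :=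
  powers_le_nonZeroDivisors_of_noZeroDivisors (X_one_ne_zero k)

instance isDomain_A : IsDomain (A k) := IsLocalization.isDomain_localization (powers_le k)

theorem algebraMap_injective : Function.Injective (algebraMap (R k) (A k)) :=
  IsLocalization.injective (A k) (powers_le k)

/-- The substitution `y₀ ↦ 0`, `y₁ ↦ y₁`. [folklore] -/
def killU : R k →ₐ[k] R k := aeval (Fin.cons 0 fun _ => X 1)

@[simp] theorem killU_X_zero : killU k (X 0) = 0 := by simp [killU]

@[simp] theorem killU_X_one : killU k (X 1) = X 1 := by
  rw [killU, aeval_X]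
  exact Fin.cons_succ (α := fun _ : Fin 2 => R k) 0 (fun _ => X 1) 0

/-- `ε : A → A`, the ring endomorphism extending `killU` (`y₁` stays a unit). [folklore] -/
def ε : A k →+* A k :=
  IsLocalization.Away.lift (X 1 : R k) (g := (algebraMap (R k) (A k)).comp (killU k).toRingHom)
    (by simpa using IsLocalization.Away.algebraMap_isUnit (S := A k) (X 1 : R k))

@[simp] theorem ε_algebraMap (r : R k) :
    ε k (algebraMap (R k) (A k) r) = algebraMap (R k) (A k) (killU k r) :=
  IsLocalization.Away.lift_eq _ _ r

/-- **The pinch ring** `O = {a ∈ k[y₀,y₁,y₁⁻¹] : a(0, y₁) ∈ k[y₀,y₁]} = k[y₁] + y₀·k[y₀,y₁,y₁⁻¹]`: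
an integrally closed, non-Noetherian domain with `O[1/y₁] = k[y₀,y₁,y₁⁻¹]`, in which `y₀` is
divisible by every power of the non-unit `y₁`. [folklore] -/
def O : Subring (A k) := (algebraMap (R k) (A k)).range.comap (ε k)

theorem mem_O {a : A k} : a ∈ O k ↔ ε k a ∈ (algebraMap (R k) (A k)).range := Iff.rfl

theorem algebraMap_mem (r : R k) : algebraMap (R k) (A k) r ∈ O k :=
  (mem_O k).mpr ⟨killU k r, (ε_algebraMap k r).symm⟩

/-- `u = y₀` and `v = y₁` as elements of `O`. [folklore] -/
def u : O k := ⟨algebraMap (R k) (A k) (X 0), algebraMap_mem k _⟩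

/-- `v = y₁ ∈ O`. [folklore] -/
def v : O k := ⟨algebraMap (R k) (A k) (X 1), algebraMap_mem k _⟩

@[simp] theorem val_u : (u k : A k) = algebraMap (R k) (A k) (X 0) := rfl
@[simp] theorem val_v : (v k : A k) = algebraMap (R k) (A k) (X 1) := rfl

theorem u_ne_zero : u k ≠ 0 := by
  intro h
  have h' : algebraMap (R k) (A k) (X 0) = 0 := congrArg Subtype.val h
  exact X_ne_zero (0 : Fin 2) (algebraMap_injective k (h'.trans (map_zero _).symm))

theorem isUnit_val_v : IsUnit (v k : A k) := IsLocalization.Away.algebraMap_isUnit (X 1 : R k)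

/-- `v` is NOT a unit of `O`: an inverse `o` would have `ε o = y₁⁻¹ ∈ k[y₀,y₁]`. [folklore] -/
theorem not_isUnit_v : ¬ IsUnit (v k) := by
  rintro hunit
  obtain ⟨o, ho⟩ := isUnit_iff_exists_inv.mp hunit
  have hoA : (v k : A k) * (o : A k) = 1 := by
    have := congrArg Subtype.val ho
    simpa using this
  obtain ⟨r, hr⟩ := (mem_O k).mp o.2
  have hε := congrArg (ε k) hoA
  rw [map_mul, map_one, val_v, ε_algebraMap, killU_X_one, ← hr, ← map_mul, ← map_one
    (algebraMap (R k) (A k))] at hε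
  have h1 : (X 1 : R k) * r = 1 := algebraMap_injective k hε
  have h2 := congrArg (MvPolynomial.eval fun _ => (0 : k)) h1
  simp at h2

/-- `u = vⁿ · (y₀ y₁⁻ⁿ)` in `O`: `u` is divisible by every power of `v`. [folklore] -/
theorem v_pow_dvd_u (n : ℕ) : v k ^ n ∣ u k := by
  let w : A k := algebraMap (R k) (A k) (X 0) * IsLocalization.Away.invSelf (S := A k) (X 1 : R k) ^ n
  have hw : w ∈ O k := by
    rw [mem_O, map_mul, ε_algebraMap, killU_X_zero, map_zero, zero_mul]
    exact ⟨0, map_zero _⟩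
  refine ⟨⟨w, hw⟩, Subtype.ext ?_⟩
  change algebraMap (R k) (A k) (X 0) =
    (algebraMap (R k) (A k) (X 1)) ^ n * (algebraMap (R k) (A k) (X 0) *
      IsLocalization.Away.invSelf (S := A k) (X 1 : R k) ^ n)
  rw [mul_left_comm, ← mul_pow, IsLocalization.Away.mul_invSelf, one_pow, mul_one]

/-- The chart map `k[y₀,y₁] → O`. [folklore] -/
def ρO : R k →+* O k := (algebraMap (R k) (A k)).codRestrict (O k) (algebraMap_mem k)

@[simp] theorem val_ρO (r : R k) : (ρO k r : A k) = algebraMap (R k) (A k) r := rfl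

theorem ρO_X_one : ρO k (X 1) = v k := rfl

theorem subtype_comp_ρO : (O k).subtype.comp (ρO k) = algebraMap (R k) (A k) := rfl

/-- `A = O[1/v]`. [folklore] -/
instance isLocalization_O_A : IsLocalization.Away (v k) (A k) := by
  refine IsLocalization.Away.mk (v k) (isUnit_val_v k) (fun s => ?_) (fun a b hab => ⟨0, ?_⟩)
  · obtain ⟨n, a, h⟩ := IsLocalization.Away.surj (X 1 : R k) s
    exact ⟨n, ρO k a, h⟩
  · have : (a : A k) = b := hab
    simpa using Subtype.ext this

theorem val_pow (n : ℕ) : ((v k ^ n : O k) : A k) = algebraMap (R k) (A k) (X 1) ^ n := by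
  simp


/-! ### The scheme: `X = ℙ²_k ∪ Spec O` glued along `D₊(x₀x₂) ≅ Spec k[y₀,y₁,y₁⁻¹] = Spec O[1/v]` -/

open CategoryTheory CategoryTheory.Limits AlgebraicGeometry
open Literature.AlgebraicGeometry.Resolution Literature.AlgebraicGeometry.Motives

attribute [local instance] MvPolynomial.gradedAlgebra ProjBaseChange.algebraBase
  ProjBaseChange.isScalarTower_localization

/-- `ℙ²_k`. [folklore] -/
abbrev P : Scheme.{0} := (projectiveSpace 2 k).left

/-- The chart `Spec k[y₀,y₁] ≅ Spec (k[x]_{x₀})₀ = D₊(x₀) ↪ ℙ²_k`. [folklore] -/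
def chartι : Spec (.of (R k)) ⟶ P k :=
  Spec.map (ProjectiveSpace.chartAlgEquiv k (0 : Fin (2 + 1))).toRingEquiv.toCommRingCatIso.hom ≫
    Proj.awayι (MvPolynomial.homogeneousSubmodule (Fin (2 + 1)) k) (X 0)
      (ProjectiveSpace.X_mem 0) zero_lt_one

instance isOpenImmersion_chartι : IsOpenImmersion (chartι k) := by
  let e := (ProjectiveSpace.chartAlgEquiv k (0 : Fin (2 + 1))).toRingEquiv.toCommRingCatIso
  haveI : IsIso (Spec.map e.hom) :=
    ⟨⟨Spec.map e.inv, by rw [← Spec.map_comp, e.inv_hom_id, Spec.map_id],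
      by rw [← Spec.map_comp, e.hom_inv_id, Spec.map_id]⟩⟩
  haveI h2 : IsOpenImmersion (Proj.awayι (MvPolynomial.homogeneousSubmodule (Fin (2 + 1)) k) (X 0)
      (ProjectiveSpace.X_mem 0) zero_lt_one) := by
    rw [← Proj.basicOpenIsoSpec_inv_ι]
    exact IsOpenImmersion.comp _ _
  exact @IsOpenImmersion.comp _ _ _ (Spec.map e.hom) _ inferInstance h2

/-- `g : Spec O → Spec k[y₀,y₁] → ℙ²_k`. [folklore] -/
def g : Spec (.of (O k)) ⟶ P k := Spec.map (CommRingCat.ofHom (ρO k)) ≫ chartι k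

/-- `j₂ : Spec A = D(v) ↪ Spec O`. [folklore] -/
def j₂ : Spec (.of (A k)) ⟶ Spec (.of (O k)) :=
  Spec.map (CommRingCat.ofHom (algebraMap (O k) (A k)))

instance isOpenImmersion_j₂ : IsOpenImmersion (j₂ k) :=
  IsOpenImmersion.of_isLocalization (v k)

/-- `j₁ : Spec A ↪ ℙ²_k` (through `Spec O`, so that the gluing square commutes by definition). [folklore] -/
def j₁ : Spec (.of (A k)) ⟶ P k := j₂ k ≫ g k

theorem j₁_eq : j₁ k = Spec.map (CommRingCat.ofHom (algebraMap (R k) (A k))) ≫ chartι k := by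
  simp only [j₁, j₂, g, ← Category.assoc, ← Spec.map_comp, ← CommRingCat.ofHom_comp]
  rfl

instance isOpenImmersion_j₁ : IsOpenImmersion (j₁ k) := by
  rw [j₁_eq]
  haveI : IsOpenImmersion (Spec.map (CommRingCat.ofHom (algebraMap (R k) (A k)))) :=
    IsOpenImmersion.of_isLocalization (X 1 : R k)
  infer_instance

instance span_map_isOpenImmersion {i j : WalkingSpan} (a : i ⟶ j) :
    IsOpenImmersion ((span (j₁ k) (j₂ k)).map a) := by
  match i, j, a with
  | _, _, WidePushoutShape.Hom.id i' =>
    rw [show WidePushoutShape.Hom.id i' = 𝟙 i' from rfl, CategoryTheory.Functor.map_id]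
    infer_instance
  | _, _, WidePushoutShape.Hom.init WalkingPair.left =>
    change IsOpenImmersion ((span (j₁ k) (j₂ k)).map WalkingSpan.Hom.fst)
    rw [span_map_fst]; exact isOpenImmersion_j₁ k
  | _, _, WidePushoutShape.Hom.init WalkingPair.right =>
    change IsOpenImmersion ((span (j₁ k) (j₂ k)).map WalkingSpan.Hom.snd)
    rw [span_map_snd]; exact isOpenImmersion_j₂ k

/-- **The witness scheme** `X = ℙ²_k ⨿_{Spec A} Spec O`. [folklore] -/
def glued : Scheme.{0} := pushout (j₁ k) (j₂ k)

/-- `ℙ²_k ↪ X`. [folklore] -/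
def ιP : P k ⟶ glued k := pushout.inl (j₁ k) (j₂ k)

/-- `Spec O ↪ X`. [folklore] -/
def ιO : Spec (.of (O k)) ⟶ glued k := pushout.inr (j₁ k) (j₂ k)

instance isOpenImmersion_ιP : IsOpenImmersion (ιP k) :=
  inferInstanceAs (IsOpenImmersion (colimit.ι (span (j₁ k) (j₂ k)) WalkingSpan.left))

instance isOpenImmersion_ιO : IsOpenImmersion (ιO k) :=
  inferInstanceAs (IsOpenImmersion (colimit.ι (span (j₁ k) (j₂ k)) WalkingSpan.right))

theorem condition : j₁ k ≫ ιP k = j₂ k ≫ ιO k := pushout.condition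

/-- `f : X → ℙ²_k`: the identity on `ℙ²_k` and `g` on `Spec O`. [folklore] -/
def toP : glued k ⟶ P k :=
  pushout.desc (𝟙 (P k)) (g k) (by rw [Category.comp_id]; rfl)

@[simp] theorem ιP_toP : ιP k ≫ toP k = 𝟙 (P k) := pushout.inl_desc _ _ _
@[simp] theorem ιO_toP : ιO k ≫ toP k = g k := pushout.inr_desc _ _ _

/-- Every point of `X` comes from `ℙ²_k` or from `Spec O`. [folklore] -/
theorem point_cases (x : glued k) : (∃ y, ιP k y = x) ∨ (∃ q, ιO k q = x) := by
  obtain ⟨i, xi, h⟩ := Scheme.IsLocallyDirected.ι_jointly_surjective (span (j₁ k) (j₂ k)) x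
  rcases i with (_ | _ | _)
  · left
    refine ⟨j₁ k xi, ?_⟩
    rw [← h, ← colimit.w (span (j₁ k) (j₂ k)) WalkingSpan.Hom.fst, Scheme.Hom.comp_apply]
    rfl
  · left; exact ⟨xi, h⟩
  · right; exact ⟨xi, h⟩

/-! ### The affine core: no resolution over a pinch -/

/-- **Spec of a domain containing a non-zero element divisible by all powers of a non-unit has no
resolution.** If `O` is a domain, `v ∈ O` a non-unit and `0 ≠ u ∈ ⋂ₙ vⁿO`, then `Spec O` admits no
proper `π : X' → Spec O` which is an isomorphism over a dense open and has regular (stalkwise)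
source: take the point `η'` over the generic point, a point `x' ∈ cl(η')` over a maximal ideal
`𝔪 ∋ v` (`π` is closed), and look at `O → B = 𝒪_{X',x'}` (local, and injective because it becomes
`O ⊆ 𝒪_{X',η'} ≅ O_{(0)}` after generization): `u ∈ ⋂ₙ 𝔪_Bⁿ = 0` by Krull's intersection theorem in
the Noetherian local domain `B`. [folklore] -/
theorem not_hasResolution_Spec_of_forall_pow_dvd {O : Type} [CommRing O] [IsDomain O]
    (u v : O) (hu : u ≠ 0) (hv : ¬ IsUnit v) (hdvd : ∀ n : ℕ, v ^ n ∣ u) :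
    ¬ Scheme.HasResolution (Spec (.of O)) := by
  rintro ⟨X', π, hπ⟩
  obtain ⟨U, hUd, -, hUiso⟩ := hπ.isBirational
  haveI := hπ.isProper
  haveI := hUiso
  -- the generic point `η` of `Spec O` lies in the dense open `U`
  let η : ↥(Spec (CommRingCat.of O)) := (⟨⊥, Ideal.isPrime_bot⟩ : PrimeSpectrum O)
  have hηgen : ∀ y : ↥(Spec (CommRingCat.of O)), η ⤳ y := fun y =>
    (PrimeSpectrum.le_iff_specializes η y).mp bot_le
  have hηU : η ∈ U := by
    obtain ⟨y, hy⟩ := hUd.nonempty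
    exact U.isOpen.stableUnderGeneralization (hηgen y) hy
  -- the point `η'` of `X'` over `η`
  let e := asIso (π ∣_ U)
  let z : ↥(π ⁻¹ᵁ U) := e.inv.base ⟨η, hηU⟩
  let η' : ↥X' := z.1
  have hπη' : π.base η' = η := by
    have h1 : (π ∣_ U).base z = ⟨η, hηU⟩ := by
      show (e.inv ≫ e.hom).base ⟨η, hηU⟩ = ⟨η, hηU⟩
      rw [e.inv_hom_id]; rfl
    have h2 := morphismRestrict_base_coe π U z
    rw [h1] at h2
    exact h2.symm
  -- a maximal ideal `M ∋ v`, i.e. a closed point `m` of `V(v)`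
  obtain ⟨M, hM, hvM⟩ := Ideal.exists_le_maximal (Ideal.span {v})
    (fun h => hv (Ideal.span_singleton_eq_top.mp h))
  have hvM' : v ∈ M := hvM (Ideal.mem_span_singleton_self v)
  let m : ↥(Spec (CommRingCat.of O)) := (⟨M, hM.isPrime⟩ : PrimeSpectrum O)
  -- `π` is closed, so some `x'` in the closure of `η'` maps to `m`
  obtain ⟨x', hx'cl, hx'm⟩ : m ∈ π.base '' closure {η'} := by
    have hc : IsClosed (π.base '' closure {η'}) := π.isClosedMap _ isClosed_closure
    have hηm : π.base η' ⤳ m := by rw [hπη']; exact hηgen m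
    exact hc.stableUnderSpecialization hηm ⟨η', subset_closure rfl, rfl⟩
  have hspec : η' ⤳ x' := specializes_iff_mem_closure.mpr hx'cl
  -- the stalk `B` at `x'`: a regular, hence Noetherian, local domain
  haveI hB : IsRegularLocalRing (X'.presheaf.stalk x') := hπ.isRegular x'
  haveI : IsDomain (X'.presheaf.stalk x') := isDomain_of_isRegularLocalRing _
  -- the ring map `ψ : O → B`
  let sO : O →+* Γ(Spec (CommRingCat.of O), ⊤) := (Scheme.ΓSpecIso (CommRingCat.of O)).inv.hom
  let ψ : O →+* X'.presheaf.stalk x' :=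
    (X'.presheaf.germ ⊤ x' trivial).hom.comp ((π.appTop).hom.comp sO)
  have hψ : ∀ a, ψ a = X'.presheaf.germ ⊤ x' trivial (π.appTop (sO a)) := fun a => rfl
  -- (i) `ψ v` is not a unit: `v` vanishes at `π x' = m`
  have hψv : ψ v ∈ IsLocalRing.maximalIdeal (X'.presheaf.stalk x') := by
    rw [IsLocalRing.mem_maximalIdeal, mem_nonunits_iff, hψ]
    intro hunit
    have hx'b : x' ∈ X'.basicOpen (π.appTop (sO v)) := (Scheme.mem_basicOpen_top _ _ _).mpr hunit
    have key : π ⁻¹ᵁ (Spec (CommRingCat.of O)).basicOpen (sO v) = X'.basicOpen (π.appTop (sO v)) :=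
      Scheme.preimage_basicOpen π (sO v)
    rw [← key] at hx'b
    have hmb : π.base x' ∈ (Spec (CommRingCat.of O)).basicOpen (sO v) := hx'b
    have key' : (Spec (CommRingCat.of O)).basicOpen (sO v) = PrimeSpectrum.basicOpen v :=
      basicOpen_eq_of_affine (R := CommRingCat.of O) v
    rw [key', hx'm] at hmb
    exact hmb hvM'
  -- (ii) `ψ` is injective: after generization to `η'` it is `O → O_{(0)} ≅ 𝒪_{X',η'}`
  have hψinj : Function.Injective ψ := by
    intro a b hab
    rw [hψ, hψ] at hab
    have hgen := congrArg (X'.presheaf.stalkSpecializes hspec) hab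
    rw [TopCat.Presheaf.germ_stalkSpecializes_apply, TopCat.Presheaf.germ_stalkSpecializes_apply]
      at hgen
    -- naturality of germs along `π` at `η'`
    have key2 : ∀ y : Γ(Spec (CommRingCat.of O), ⊤),
        X'.presheaf.germ ⊤ η' trivial (π.appTop y) =
          π.stalkMap η' ((Spec (CommRingCat.of O)).presheaf.germ ⊤ (π.base η') trivial y) :=
      fun y => (Scheme.Hom.germ_stalkMap_apply π ⊤ η' trivial y).symm
    rw [key2, key2] at hgen
    -- `π.stalkMap η'` is an isomorphism (`π` is an isomorphism over `U ∋ π η'`)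
    have hiso : IsIso (π.stalkMap η') :=
      ((MorphismProperty.isomorphisms CommRingCat).arrow_mk_iso_iff
        (morphismRestrictStalkMap π U z)).mp (show IsIso ((π ∣_ U).stalkMap z) from inferInstance)
    have hgen' := (asIso (π.stalkMap η')).commRingCatIsoToRingEquiv.injective hgen
    -- the germ map `O → 𝒪_{Spec O, π η'}` is the localisation map of a domain, injective
    have hloc : Function.Injective
        (algebraMap O ((Spec.structureSheaf O).presheaf.stalk (π.base η'))) :=
      IsLocalization.injective (M := (π.base η').asIdeal.primeCompl) _
        (Ideal.primeCompl_le_nonZeroDivisors _)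
    exact hloc hgen'
  -- (iii) Krull: `ψ u ∈ ⋂ₙ 𝔪_Bⁿ = 0`
  have hψu : ψ u ∈ (⨅ n : ℕ, IsLocalRing.maximalIdeal (X'.presheaf.stalk x') ^ n) := by
    refine Ideal.mem_iInf.mpr fun n => ?_
    obtain ⟨w, hw⟩ := hdvd n
    rw [hw, map_mul, map_pow]
    exact Ideal.mul_mem_right _ _ (Ideal.pow_mem_pow hψv n)
  have hbot := Ideal.iInf_pow_eq_bot_of_isDomain (I := IsLocalRing.maximalIdeal (X'.presheaf.stalk x'))
    (IsLocalRing.maximalIdeal.isMaximal _).ne_top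
  have h0 : ψ u = 0 := by simpa using hbot.le hψu
  exact hu (hψinj (h0.trans (map_zero ψ).symm))


/-! ### The four properties of `f : X → ℙ²_k` -/

/-- `X` is reduced (covered by the reduced `ℙ²_k` and `Spec O`). [folklore] -/
theorem isReduced_glued : IsReduced (glued k) := by
  haveI : IsIntegral (P k) := isIntegral_projectiveSpace 2 k
  refine Scheme.isReduced_of_forall_exists_isOpenImmersion fun x => ?_
  rcases point_cases k x with ⟨y, rfl⟩ | ⟨q, rfl⟩
  · exact ⟨P k, ιP k, inferInstance, ⟨y, rfl⟩, inferInstance⟩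
  · exact ⟨_, ιO k, inferInstance, ⟨q, rfl⟩, inferInstance⟩

/-- `X` is irreducible: the two irreducible open pieces meet (in the image of `Spec A`). [folklore] -/
theorem irreducibleSpace_glued : IrreducibleSpace (glued k) := by
  haveI : IsIntegral (P k) := isIntegral_projectiveSpace 2 k
  haveI : IrreducibleSpace ↥(Spec (CommRingCat.of (O k))) :=
    inferInstanceAs (IrreducibleSpace (PrimeSpectrum (O k)))
  let U : Bool → Set (glued k) := fun b => cond b (Set.range (ιP k)) (Set.range (ιO k))
  refine ProjectiveSpace.irreducibleSpace_of_iUnion_eq_univ U ?_ ?_ ?_ true ?_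
  · refine Set.eq_univ_of_forall fun x => Set.mem_iUnion.mpr ?_
    rcases point_cases k x with ⟨y, rfl⟩ | ⟨q, rfl⟩
    · exact ⟨true, y, rfl⟩
    · exact ⟨false, q, rfl⟩
  · rintro (_ | _)
    · exact (ιO k).isOpenEmbedding.isOpen_range
    · exact (ιP k).isOpenEmbedding.isOpen_range
  · rintro (_ | _)
    · simpa [U, Set.image_univ] using
        (IrreducibleSpace.isIrreducible_univ ↥(Spec (CommRingCat.of (O k)))).image _
          (ιO k).continuous.continuousOn
    · simpa [U, Set.image_univ] using
        (IrreducibleSpace.isIrreducible_univ ↥(P k)).image _ (ιP k).continuous.continuousOn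
  · rintro (_ | _)
    · obtain ⟨a⟩ : Nonempty ↥(Spec (CommRingCat.of (A k))) :=
        inferInstanceAs (Nonempty (PrimeSpectrum (A k)))
      refine ⟨ιO k (j₂ k a), ⟨j₂ k a, rfl⟩, ⟨j₁ k a, ?_⟩⟩
      rw [← Scheme.Hom.comp_apply, condition, Scheme.Hom.comp_apply]
    · obtain ⟨y⟩ : Nonempty ↥(P k) := inferInstance
      exact ⟨ιP k y, ⟨y, rfl⟩, ⟨y, rfl⟩⟩

/-- `X` is integral. [folklore] -/
theorem isIntegral_glued : IsIntegral (glued k) := by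
  haveI := isReduced_glued k
  haveI := irreducibleSpace_glued k
  exact isIntegral_of_irreducibleSpace_of_isReduced _

/-- `f` is surjective (it is the identity on the piece `ℙ²_k`). [folklore] -/
theorem toP_surjective : Function.Surjective (toP k).base := by
  intro y
  refine ⟨(ιP k).base y, ?_⟩
  show (ιP k ≫ toP k).base y = y
  rw [ιP_toP]
  rfl

/-- Points of `Spec O` that `g` maps into the chart `D₊(x₂)` lie in `D(v)`: under the chart,
`x₂/x₀ ↦ y₁ ↦ v`. [folklore] -/
theorem v_not_mem_of_g_mem {q : ↥(Spec (CommRingCat.of (O k)))}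
    (hq : g k q ∈ Proj.basicOpen (MvPolynomial.homogeneousSubmodule (Fin (2 + 1)) k) (MvPolynomial.X 2)) :
    (v k : O k) ∉ q.asIdeal := by
  have key := Proj.awayι_preimage_basicOpen (MvPolynomial.homogeneousSubmodule (Fin (2 + 1)) k)
    (ProjectiveSpace.X_mem (0 : Fin (2 + 1))) zero_lt_one (ProjectiveSpace.X_mem (2 : Fin (2 + 1)))
    zero_lt_one
  let e := (ProjectiveSpace.chartAlgEquiv k (0 : Fin (2 + 1))).toRingEquiv.toCommRingCatIso
  have h1 : Spec.map e.hom (Spec.map (CommRingCat.ofHom (ρO k)) q) ∈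
      Proj.awayι (MvPolynomial.homogeneousSubmodule (Fin (2 + 1)) k) (MvPolynomial.X 0)
        (ProjectiveSpace.X_mem 0) zero_lt_one ⁻¹ᵁ
        Proj.basicOpen (MvPolynomial.homogeneousSubmodule (Fin (2 + 1)) k) (MvPolynomial.X 2) := hq
  rw [key] at h1
  -- `h1` now says: the element `x₂/x₀` is not in the prime `e⁻¹(ρO⁻¹(q))`
  have h2 : ρO k (ProjectiveSpace.chartAlgEquiv k (0 : Fin (2 + 1))
      (HomogeneousLocalization.Away.isLocalizationElem (ProjectiveSpace.X_mem (0 : Fin (2 + 1)))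
        (ProjectiveSpace.X_mem (2 : Fin (2 + 1))))) ∉ q.asIdeal := h1
  have helem : ProjectiveSpace.chartAlgEquiv k (0 : Fin (2 + 1))
      (HomogeneousLocalization.Away.isLocalizationElem (ProjectiveSpace.X_mem (0 : Fin (2 + 1)))
        (ProjectiveSpace.X_mem (2 : Fin (2 + 1)))) = MvPolynomial.X 1 := by
    show ProjectiveSpace.ofChartRingHom k (0 : Fin (2 + 1)) _ = _
    rw [ProjectiveSpace.ofChartRingHom_mk]
    have h22 : (2 : Fin (2 + 1)) = Fin.succAbove 0 1 := by decide
    rw [pow_one, h22, ProjectiveSpace.dehomogenize_X_succAbove]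
  rw [helem, ρO_X_one] at h2
  exact h2

/-- `f` is an open immersion over the chart `D₊(x₂)`: `f⁻¹(D₊(x₂))` lies in the piece `ℙ²_k` (a point
of `Spec O` over `D₊(x₂)` lies in `D(v) = Spec A`, which is glued into `ℙ²_k`), and `f` is the
identity there. [folklore] -/
theorem isOpenImmersion_toP_restrict :
    IsOpenImmersion (toP k ∣_ Proj.basicOpen (MvPolynomial.homogeneousSubmodule (Fin (2 + 1)) k)
      (MvPolynomial.X (Fin.last 2))) := by
  set W : (P k).Opens := Proj.basicOpen (MvPolynomial.homogeneousSubmodule (Fin (2 + 1)) k)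
      (MvPolynomial.X (Fin.last 2)) with hW
  have hrange : Set.range (toP k ⁻¹ᵁ W).ι.base ⊆ Set.range (ιP k).base := by
    rintro _ ⟨x, rfl⟩
    have hx : toP k x.1 ∈ W := x.2
    rcases point_cases k x.1 with ⟨y, hy⟩ | ⟨q, hq⟩
    · exact ⟨y, hy⟩
    · rw [← hq, ← Scheme.Hom.comp_apply, ιO_toP] at hx
      have hv := v_not_mem_of_g_mem k hx
      have hq' : q ∈ Set.range (PrimeSpectrum.comap (algebraMap (O k) (A k))) := by
        rw [PrimeSpectrum.localization_away_comap_range (A k) (v k)]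
        exact hv
      obtain ⟨a, ha⟩ := hq'
      refine ⟨j₁ k a, ?_⟩
      show (ιP k) (j₁ k a) = x.1
      rw [← Scheme.Hom.comp_apply, condition, Scheme.Hom.comp_apply, ← hq]
      congr 1
  let l := IsOpenImmersion.lift (ιP k) (toP k ⁻¹ᵁ W).ι hrange
  have hl : l ≫ ιP k = (toP k ⁻¹ᵁ W).ι := IsOpenImmersion.lift_fac _ _ hrange
  haveI : IsOpenImmersion l := by
    haveI : IsOpenImmersion (l ≫ ιP k) := by rw [hl]; infer_instance
    exact IsOpenImmersion.of_comp l (ιP k)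
  have hfW : (toP k ∣_ W) ≫ W.ι = l := by
    rw [morphismRestrict_ι, ← hl, Category.assoc, ιP_toP, Category.comp_id]
  haveI : IsOpenImmersion ((toP k ∣_ W) ≫ W.ι) := by rw [hfW]; infer_instance
  exact IsOpenImmersion.of_comp (toP k ∣_ W) W.ι

/-- `X` has no resolution: a resolution would restrict to the open piece `Spec O`. [folklore] -/
theorem not_hasResolution_glued : ¬ Scheme.HasResolution (glued k) := fun h =>
  not_hasResolution_Spec_of_forall_pow_dvd (u k) (v k) (u_ne_zero k) (not_isUnit_v k)
    (v_pow_dvd_u k) (Scheme.HasResolution.of_isOpenImmersion (ιO k) h)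

end PinchWitness


/-- **`IsFinite f` is load-bearing in `CoverResolution` (dimension `2`): the crux with the finiteness
hypothesis deleted is FALSE.** Witness: `p = 2`, `k = 𝔽₂`, `n = 2`, `X = ℙ²_k ∪ Spec O` glued along
`D₊(x₀x₂) ≅ Spec k[y₀,y₁,y₁⁻¹] = Spec O[1/v]` (`PinchWitness.glued`), where
`O = k[y₁] + y₀·k[y₀,y₁,y₁⁻¹]` is the pinch ring (`PinchWitness.O`); `f = 𝟙 ∪ (Spec O → Spec k[y₀,y₁]
= D₊(x₀))` (`PinchWitness.toP`). Then `X` is integral, `f` is surjective and an open immersion over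
`D₊(x₂)`, but `X` has no resolution (`PinchWitness.not_hasResolution_glued`: Krull's intersection
theorem at a point over the pinch, `not_hasResolution_Spec_of_forall_pow_dvd`). `f` is not finite —
not even of finite type — over `[1:0:0]`. In dimension `n ≤ 1` finiteness is NOT load-bearing
(module docstring, item 4). [folklore] -/
theorem coverResolution_false_without_isFinite : ¬ WithoutIsFinite := by
  intro h
  letI := MvPolynomial.gradedAlgebra (σ := Fin (2 + 1)) (R := ZMod 2)
  haveI := PinchWitness.isOpenImmersion_toP_restrict (ZMod 2)
  exact PinchWitness.not_hasResolution_glued (ZMod 2)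
    (h 2 Nat.prime_two (ZMod 2) 2 (PinchWitness.glued (ZMod 2)) (PinchWitness.toP (ZMod 2))
      (PinchWitness.isIntegral_glued (ZMod 2)) (PinchWitness.toP_surjective (ZMod 2)) inferInstance)


/-! ## 8. Line `strategy-split` (cycle 2): the stubs, their position, and `IsFinite` in P1

The lead's picked line (`Cruxes/CoverResolution/Lines/strategy_split.lean`, `PICKED.md`) is the
crux-strategist's split `P1 → P3 → P2 → CoverResolution`:
P1 `stub_boundaryLogRegularization` (∀ Kedlaya cover, ∀ `h ∉ D₊(xₙ)`, ∃ open `B ∋ h` of `ℙⁿ_k` and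
a proper birational `π : Y → f⁻¹(B)` with `Y` log regular for fs étale charts,
`Scheme.IsLogRegularEtale`), P3 `stub_logRegularPatching` (models over `B₁`, `B₂` ⇒ a model over
`B₁ ⊔ B₂`), P2 `stub_logRegularResolution` (quasi-compact + `IsLogRegularEtale` ⇒ `HasResolution`).

FINDINGS (everything cited is LANDED unless marked PAPER):
* **Joint sufficiency holds with no gap**: `Theorems.coverResolution_of_subs` (p160185) is the
  composition, sorry-free; nothing is smuggled (`CoverResolution_of` is `exact` that theorem).
* **P1 and P3 are consequences of the crux, hence of the summit** —
  `Theorems.boundaryLogRegularization_of_coverResolution` (take `B = ⊤`!) and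
  `Theorems.logRegularPatching_of_coverResolution` (p160676): so, like the crux (§1), NEITHER STUB
  IS REFUTABLE short of `¬` resolution over a perfect field; and **P2 ↔ the named fact**
  `Niziol2006_logRegularScheme_hasResolution` at universe 0 (`logRegularResolution_iff_niziol2006`).
  Modulo P2 the split is an equivalence: `coverResolution_iff_local_and_patching`.
* **P2's interface has no junk model that I could find** (definitions read symbol by symbol:
  `EtaleLogAtlas`, `EtaleLogAtlas.IsLogRegular`, `LogChart.IsLogRegularLocal`): Kato's (2.1) is
  rendered as `R ⧸ I` regular AND `dim R = dim (R ⧸ I) + (n − rk Fᵍᵖ)` for the chart through the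
  Zariski local ring of each étale chart domain; the dimension clause kills the fat point (PAPER:
  `dim R = 0` forces `rk Fᵍᵖ = n`, a face of full rank of a monoid spanning `ℤⁿ` is everything, so
  `I = ⊥` and `R` is regular — `Spec k[ε]` is NOT `IsLogRegularEtale`, consistent with
  `not_hasResolution_spec_dualNumber`); compatibility is asked over ALL ordered pairs `(i, j)`
  including `i = j` (off-diagonal points of `U i ×_X U i`), which is what étale descent of the
  subsheaf `M ⊆ 𝒪` needs; local Noetherianity is a field of `IsLogRegular`. So P2 is Nizioł 2006
  Cor. 5.7 / Thm. 5.10 faithfully — KNOWN, an L-sized formalisation debt, not a target.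
* **`IsFinite f` is load-bearing in P1** (Lean, this section):
  `boundaryLogRegularization_false_without_isFinite` — with finiteness deleted P1 is FALSE, by the
  pinch cover of §4 and the point `h = f(𝔪) ∈ V₊(x₂)` under the pinch point `𝔪 ∋ v`: for EVERY
  open `B ∋ h`, `f⁻¹(B)` has no proper birational model whose source is merely LOCALLY NOETHERIAN
  (`PinchWitness.no_noetherianModel_over_open`, from the sharpened affine core
  `no_noetherianModel_near_pinch`: Krull's intersection theorem needs Noetherianity of ONE stalk of
  the model over the pinch, nothing about regularity), and a log regular `Y` is locally Noetherian
  by definition. Base-locality (`∃ B ∋ h`) buys nothing against a non-Noetherian point over `H`.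
  Landed def-free as `Theorems/CoverResolution/Negative/BoundaryLogRegularizationFalseWithoutIsFinite.lean`
  (p162912).
* **`IsIntegral X` is load-bearing in P1, modulo Kato 1994 (4.1)** (Lean, §8b):
  `boundaryLogRegularization_false_without_isIntegral_of_kato1994` — same witness as §2
  (`X = ℙ¹ ⨿ Spec k[ε]`, `h = [1:0]`): for any `B ∋ h` the fat summand is OPEN in `f⁻¹(B)`, so
  the dense open `U` of a birational `π` meets it and `Y` acquires a stalk isomorphic to a
  localization of `k[ε]` (`not_isDomain_stalk_spec_dualNumber`); but stalks of a log regular `Y`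
  are domains — `isDomain_stalk_of_isLogRegularEtale`, granted the NAMED FACT
  `Kato1994_logRegularLocal_isIntegrallyClosed` (Kato (4.1), vendored, unproved; the étale-to-
  Zariski transfer is cheap: étale stalk maps are flat local, hence faithfully flat, hence
  injective). Unconditionally I cannot exclude the fat point from `IsLogRegularEtale` without
  either (4.1) or the dimension theory of étale local homomorphisms (PAPER: dim 0 log regular ⇒
  unit face of full rank ⇒ chart by units ⇒ regular). Landed def-free as
  `Theorems/CoverResolution/Negative/BoundaryLogRegularizationFalseWithoutIsIntegral.lean` (p163441).
* **`PerfectField`, `Etale`, `Surjective`, `p.Prime` are decoration in P1 and P3** exactly as in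
  the crux (§1, §3 of the index): summit ⇒ crux ⇒ P1 ∧ P3 with those hypotheses unused.
* **P3's hypotheses resist mutation by local witnesses** (PAPER): with the pinch (or fat-point)
  cover, `f⁻¹(B)` has a model iff `B` avoids the one bad point of `H`, so whenever the conclusion
  of P3 fails for `B₁ ⊔ B₂` one of its two hypotheses already fails — P3 minus `IsFinite` / minus
  `IsIntegral` is not refuted this way (and may well be true: P3 is a statement about OVERLAPS).
  Degenerate cases of P3 are trivially true: `B₁ = ⊥` (the empty scheme is log regular with the
  empty atlas), `B₁ ≤ B₂`, `B₁ ⊓ B₂ = ⊥` (disjoint union of models). The content of P3 is Zariski's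
  patching problem over a genuine overlap — open in dimension ≥ 4, summit-implied, irrefutable here.
* No `-- Targets`: the lead's STUCK list is empty (verdict `promote-stub`: P1/P3 are the READY
  split children, P2 is literature debt). When the split is applied, the children inherit this
  analysis verbatim (their statements are the stubs' statements).
-/

/-- P1 `BoundaryLogRegularization` (= `StrategySplit.stub_boundaryLogRegularization`, child 1/3 of
the split) with the hypothesis `IsFinite f` DELETED, everything else verbatim. [folklore] -/
def BoundaryLogRegularizationWithoutIsFinite : Prop :=
  ∀ p : ℕ, p.Prime → ∀ (k : Type) [Field k] [CharP k p] [PerfectField k] (n : ℕ)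
    (X : AlgebraicGeometry.Scheme.{0})
    (f : X ⟶ (Literature.AlgebraicGeometry.Motives.projectiveSpace n k).left),
    AlgebraicGeometry.IsIntegral X → Function.Surjective f.base →
    (letI := MvPolynomial.gradedAlgebra (σ := Fin (n + 1)) (R := k);
      AlgebraicGeometry.Etale (f ∣_ (AlgebraicGeometry.Proj.basicOpen
        (MvPolynomial.homogeneousSubmodule (Fin (n + 1)) k) (MvPolynomial.X (Fin.last n))))) →
    ∀ h : (Literature.AlgebraicGeometry.Motives.projectiveSpace n k).left,
    (letI := MvPolynomial.gradedAlgebra (σ := Fin (n + 1)) (R := k);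
      h ∉ AlgebraicGeometry.Proj.basicOpen (MvPolynomial.homogeneousSubmodule (Fin (n + 1)) k)
        (MvPolynomial.X (Fin.last n))) →
    ∃ B : (Literature.AlgebraicGeometry.Motives.projectiveSpace n k).left.Opens, h ∈ B ∧
      ∃ (Y : AlgebraicGeometry.Scheme.{0})
        (π : Y ⟶ ((f ⁻¹ᵁ B : X.Opens) : AlgebraicGeometry.Scheme.{0})),
        AlgebraicGeometry.IsProper π ∧ Literature.AlgebraicGeometry.Resolution.IsBirational π ∧
          Literature.AlgebraicGeometry.Resolution.Scheme.IsLogRegularEtale Y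

/-- **No locally Noetherian proper birational model near a pinch** (the affine core of §4,
sharpened from "regular source" to "locally Noetherian source"). Let `O` be a domain with an
element `u ≠ 0` divisible by every power of `v`. If `ι : W ↪ Spec O` is an open immersion whose
image contains a point of `V(v)`, then `W` admits NO proper `π : Y → W` that is an isomorphism over
a dense open of `W` and has locally Noetherian source — regular, log regular (toric) or otherwise.
Proof: `W` is integral with generic point `η_W ∈ U`; the point `η'` of `Y` over it specializes
(`π` is closed) to some `x'` over the given point `w₀` of `V(v)`; `ψ : O → B = 𝒪_{Y,x'}` through
`π ≫ ι` sends `v` into `𝔪_B` and is injective (after generization to `η'` it is a localization map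
of the domain `O` followed by the isomorphism `(π ≫ ι).stalkMap η'`), so `ψ u ∈ ⋂ₙ 𝔪_Bⁿ = 0`
(Krull, Noetherian local `B`) contradicts `u ≠ 0`. [folklore] -/
theorem no_noetherianModel_near_pinch {O : Type} [CommRing O] [IsDomain O]
    (u v : O) (hu : u ≠ 0) (hdvd : ∀ n : ℕ, v ^ n ∣ u)
    {W : Scheme.{0}} (ι : W ⟶ Spec (.of O)) [IsOpenImmersion ι]
    (w₀ : W) (hw₀ : v ∈ (ι.base w₀).asIdeal)
    {Y : Scheme.{0}} (π : Y ⟶ W) [IsProper π] (hbir : IsBirational π)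
    [IsLocallyNoetherian Y] : False := by
  obtain ⟨U, hUd, -, hUiso⟩ := hbir
  haveI := hUiso
  -- `W` is integral with generic point `ηW ∈ U`
  haveI : Nonempty W := ⟨w₀⟩
  haveI : IsIntegral (Spec (CommRingCat.of O)) := (affine_isIntegral_iff _).mpr inferInstance
  haveI : IsIntegral W := isIntegral_of_isOpenImmersion ι
  let ηW : W := genericPoint W
  have hgen : ∀ w : W, ηW ⤳ w := genericPoint_specializes
  have hηU : ηW ∈ U := by
    obtain ⟨y, hy⟩ := hUd.nonempty
    exact U.isOpen.stableUnderGeneralization (hgen y) hy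
  -- the point `η'` of `Y` over `ηW`
  let e := asIso (π ∣_ U)
  let z : ↥(π ⁻¹ᵁ U) := e.inv.base ⟨ηW, hηU⟩
  let η' : Y := z.1
  have hπη' : π.base η' = ηW := by
    have h1 : (π ∣_ U).base z = ⟨ηW, hηU⟩ := by
      show (e.inv ≫ e.hom).base ⟨ηW, hηU⟩ = ⟨ηW, hηU⟩
      rw [e.inv_hom_id]; rfl
    have h2 := morphismRestrict_base_coe π U z
    rw [h1] at h2
    exact h2.symm
  -- `π` is closed, so some `x'` in the closure of `η'` maps to `w₀`
  obtain ⟨x', hx'cl, hx'm⟩ : w₀ ∈ π.base '' closure {η'} := by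
    have hc : IsClosed (π.base '' closure {η'}) := π.isClosedMap _ isClosed_closure
    have hηm : π.base η' ⤳ w₀ := by rw [hπη']; exact hgen w₀
    exact hc.stableUnderSpecialization hηm ⟨η', subset_closure rfl, rfl⟩
  have hspec : η' ⤳ x' := specializes_iff_mem_closure.mpr hx'cl
  -- the ring map `ψ : O → B = 𝒪_{Y,x'}` through `φ = π ≫ ι`
  let φ : Y ⟶ Spec (.of O) := π ≫ ι
  let sO : O →+* Γ(Spec (CommRingCat.of O), ⊤) := (Scheme.ΓSpecIso (CommRingCat.of O)).inv.hom
  let ψ : O →+* Y.presheaf.stalk x' :=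
    (Y.presheaf.germ ⊤ x' trivial).hom.comp ((φ.appTop).hom.comp sO)
  have hψ : ∀ a, ψ a = Y.presheaf.germ ⊤ x' trivial (φ.appTop (sO a)) := fun a => rfl
  -- (i) `ψ v` is not a unit: `v` vanishes at `φ x' = ι w₀`
  have hψv : ψ v ∈ IsLocalRing.maximalIdeal (Y.presheaf.stalk x') := by
    rw [IsLocalRing.mem_maximalIdeal, mem_nonunits_iff, hψ]
    intro hunit
    have hx'b : x' ∈ Y.basicOpen (φ.appTop (sO v)) := (Scheme.mem_basicOpen_top _ _ _).mpr hunit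
    have key : φ ⁻¹ᵁ (Spec (CommRingCat.of O)).basicOpen (sO v) = Y.basicOpen (φ.appTop (sO v)) :=
      Scheme.preimage_basicOpen φ (sO v)
    rw [← key] at hx'b
    have hmb : φ.base x' ∈ (Spec (CommRingCat.of O)).basicOpen (sO v) := hx'b
    have key' : (Spec (CommRingCat.of O)).basicOpen (sO v) = PrimeSpectrum.basicOpen v :=
      basicOpen_eq_of_affine (R := CommRingCat.of O) v
    have hφx' : φ.base x' = ι.base w₀ := by
      show ι.base (π.base x') = ι.base w₀
      rw [hx'm]
    rw [key', hφx'] at hmb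
    exact hmb hw₀
  -- (ii) `ψ` is injective
  have hψinj : Function.Injective ψ := by
    intro a b hab
    rw [hψ, hψ] at hab
    have hgen' := congrArg (Y.presheaf.stalkSpecializes hspec) hab
    rw [TopCat.Presheaf.germ_stalkSpecializes_apply, TopCat.Presheaf.germ_stalkSpecializes_apply]
      at hgen'
    have key2 : ∀ y : Γ(Spec (CommRingCat.of O), ⊤),
        Y.presheaf.germ ⊤ η' trivial (φ.appTop y) =
          φ.stalkMap η' ((Spec (CommRingCat.of O)).presheaf.germ ⊤ (φ.base η') trivial y) :=
      fun y => (Scheme.Hom.germ_stalkMap_apply φ ⊤ η' trivial y).symm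
    rw [key2, key2] at hgen'
    have hisoπ : IsIso (π.stalkMap η') :=
      ((MorphismProperty.isomorphisms CommRingCat).arrow_mk_iso_iff
        (morphismRestrictStalkMap π U z)).mp (show IsIso ((π ∣_ U).stalkMap z) from inferInstance)
    have hισ : ∀ w : W, IsIso (ι.stalkMap w) := fun w => inferInstance
    have hiso : IsIso (φ.stalkMap η') := by
      rw [show φ.stalkMap η' = ι.stalkMap (π.base η') ≫ π.stalkMap η' from
        Scheme.Hom.stalkMap_comp π ι η']
      exact @IsIso.comp_isIso _ _ _ _ _ _ _ (hισ (π.base η')) hisoπ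
    have hgen'' := (asIso (φ.stalkMap η')).commRingCatIsoToRingEquiv.injective hgen'
    have hloc : Function.Injective
        (algebraMap O ((Spec.structureSheaf O).presheaf.stalk (φ.base η'))) :=
      IsLocalization.injective (M := (φ.base η').asIdeal.primeCompl) _
        (Ideal.primeCompl_le_nonZeroDivisors _)
    exact hloc hgen''
  -- (iii) Krull: `ψ u ∈ ⋂ₙ 𝔪_Bⁿ = 0`
  have hψu : ψ u ∈ (⨅ n : ℕ, IsLocalRing.maximalIdeal (Y.presheaf.stalk x') ^ n) := by
    refine Ideal.mem_iInf.mpr fun n => ?_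
    obtain ⟨w, hw⟩ := hdvd n
    rw [hw, map_mul, map_pow]
    exact Ideal.mul_mem_right _ _ (Ideal.pow_mem_pow hψv n)
  have hbot := Ideal.iInf_pow_eq_bot_of_isLocalRing
    (IsLocalRing.maximalIdeal (Y.presheaf.stalk x')) (IsLocalRing.maximalIdeal.isMaximal _).ne_top
  have h0 : ψ u = 0 := by simpa using hbot.le hψu
  exact hu (hψinj (h0.trans (map_zero ψ).symm))

/-- **Models transport along open immersions into the target**: if `π : Y → T` is proper birational
with `Y` locally Noetherian and `e : V ↪ T` is an open immersion, then `V` has a proper birational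
model with locally Noetherian source (restrict over the image of `e`, compose with `e⁻¹`).
[folklore] -/
theorem exists_noetherianModel_of_isOpenImmersion {Y T V : Scheme.{0}} (π : Y ⟶ T) [IsProper π]
    (hbir : IsBirational π) [IsLocallyNoetherian Y] (e : V ⟶ T) [IsOpenImmersion e] :
    ∃ (Y' : Scheme.{0}) (π' : Y' ⟶ V), IsProper π' ∧ IsBirational π' ∧ IsLocallyNoetherian Y' := by
  refine ⟨(π ⁻¹ᵁ e.opensRange : Scheme.{0}), (π ∣_ e.opensRange) ≫ e.isoOpensRange.inv,
    inferInstance, (hbir.morphismRestrict e.opensRange).comp_iso e.isoOpensRange.inv,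
    inferInstance⟩

namespace PinchWitness

variable (k : Type) [Field k]

attribute [local instance] MvPolynomial.gradedAlgebra ProjBaseChange.algebraBase
  ProjBaseChange.isScalarTower_localization

/-- **The pinch point**: `v` lies in some prime of `O` (it is a non-unit; in fact `V(v)` is the
single closed point `𝔪 = (y₁) + y₀·A`, `O/vO = k`). [folklore] -/
theorem exists_pinchPoint : ∃ q₀ : ↥(Spec (CommRingCat.of (O k))), v k ∈ q₀.asIdeal := by
  obtain ⟨M, hM, hvM⟩ := Ideal.exists_le_maximal (Ideal.span {v k})
    (fun h => not_isUnit_v k (Ideal.span_singleton_eq_top.mp h))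
  exact ⟨⟨M, hM.isPrime⟩, hvM (Ideal.mem_span_singleton_self _)⟩

/-- The pinch point lies over the hyperplane at infinity: `g q₀ ∉ D₊(x₂)` when `v ∈ q₀`. [folklore] -/
theorem g_not_mem_chart_of_v_mem {q₀ : ↥(Spec (CommRingCat.of (O k)))} (hq₀ : v k ∈ q₀.asIdeal) :
    g k q₀ ∉ Proj.basicOpen (MvPolynomial.homogeneousSubmodule (Fin (2 + 1)) k)
      (MvPolynomial.X (Fin.last 2)) :=
  fun hq => v_not_mem_of_g_mem k hq hq₀

/-- **No locally Noetherian model over a base open containing the image of the pinch point**: for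
any morphism `f : X → T` from the pinch scheme `X = ℙ²_k ∪ Spec O`, any `q₀ ∈ V(v) ⊆ Spec O` and
any open `B ⊆ T` with `f(ι_O q₀) ∈ B`, the open `f⁻¹(B)` has no proper birational model with
locally Noetherian source (transport to the open `ι_O⁻¹ f⁻¹(B)` of `Spec O`, then
`no_noetherianModel_near_pinch`). [folklore] -/
theorem no_noetherianModel_over_open {T : Scheme.{0}} (f : glued k ⟶ T)
    (q₀ : ↥(Spec (CommRingCat.of (O k)))) (hq₀ : v k ∈ q₀.asIdeal)
    (B : T.Opens) (hB : f (ιO k q₀) ∈ B)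
    {Y : Scheme.{0}} (π : Y ⟶ ((f ⁻¹ᵁ B : (glued k).Opens) : Scheme.{0})) [IsProper π]
    (hbir : IsBirational π) [IsLocallyNoetherian Y] : False := by
  obtain ⟨Y', π', hπ', hbir', hN'⟩ :=
    exists_noetherianModel_of_isOpenImmersion π hbir (ιO k ∣_ (f ⁻¹ᵁ B))
  haveI := hπ'
  haveI := hN'
  have hq₀V : q₀ ∈ ιO k ⁻¹ᵁ (f ⁻¹ᵁ B) := hB
  exact no_noetherianModel_near_pinch (u k) (v k) (u_ne_zero k) (v_pow_dvd_u k)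
    (ιO k ⁻¹ᵁ (f ⁻¹ᵁ B)).ι ⟨q₀, hq₀V⟩ hq₀ π' hbir'

end PinchWitness

/-- **`IsFinite f` is load-bearing in P1 `BoundaryLogRegularization`**: with finiteness deleted,
the stub / child P1 is FALSE. Witness: the pinch cover of §4 (`p = 2`, `k = 𝔽₂`, `n = 2`,
`X = ℙ²_k ∪ Spec O`, `f = toP`) and `h = f(ι_O 𝔪)`, `𝔪 ∋ v` the pinch point, which lies on
`V₊(x₂)`; for every `B ∋ h`, `f⁻¹(B)` has no proper birational locally Noetherian model
(`PinchWitness.no_noetherianModel_over_open`), while a log regular `Y` is locally Noetherian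
(`EtaleLogAtlas.IsLogRegular.isLocallyNoetherian`). Def-free landing:
`Theorems/CoverResolution/Negative/BoundaryLogRegularizationFalseWithoutIsFinite.lean`. [folklore] -/
theorem boundaryLogRegularization_false_without_isFinite :
    ¬ BoundaryLogRegularizationWithoutIsFinite := by
  intro H
  letI := MvPolynomial.gradedAlgebra (σ := Fin (2 + 1)) (R := ZMod 2)
  haveI := PinchWitness.isOpenImmersion_toP_restrict (ZMod 2)
  obtain ⟨q₀, hq₀⟩ := PinchWitness.exists_pinchPoint (ZMod 2)
  have hh : PinchWitness.toP (ZMod 2) (PinchWitness.ιO (ZMod 2) q₀) ∉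
      Proj.basicOpen (MvPolynomial.homogeneousSubmodule (Fin (2 + 1)) (ZMod 2))
        (MvPolynomial.X (Fin.last 2)) := by
    rw [← Scheme.Hom.comp_apply, PinchWitness.ιO_toP]
    exact PinchWitness.g_not_mem_chart_of_v_mem (ZMod 2) hq₀
  obtain ⟨B, hhB, Y, π, hπ, hbir, 𝒜, h𝒜⟩ :=
    H 2 Nat.prime_two (ZMod 2) 2 (PinchWitness.glued (ZMod 2)) (PinchWitness.toP (ZMod 2))
      (PinchWitness.isIntegral_glued (ZMod 2)) (PinchWitness.toP_surjective (ZMod 2)) inferInstance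
      _ hh
  haveI := hπ
  haveI := h𝒜.isLocallyNoetherian
  exact PinchWitness.no_noetherianModel_over_open (ZMod 2) (PinchWitness.toP (ZMod 2)) q₀ hq₀ B hhB
    π hbir


/-! ### §8b. `IsIntegral X` is load-bearing in P1, modulo Kato 1994 (4.1) (Lean) -/

/-- **Stalks of a log regular scheme (fs étale charts) are domains, modulo Kato 1994 (4.1).**
If `Y` carries a log regular atlas of fs étale charts (`Scheme.IsLogRegularEtale`) then every
local ring `𝒪_{Y,y}` is a domain, granted the named fact
`Kato1994_logRegularLocal_isIntegrallyClosed` (log regular local rings are normal domains): pick a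
chart `U_i → Y` and `u ↦ y`; `𝒪_{U_i,u}` is Noetherian local (étale over locally Noetherian) and
log regular for the chart, hence a domain by (4.1); the stalk map `𝒪_{Y,y} → 𝒪_{U_i,u}` of the
étale (flat) structure map is a flat local homomorphism, hence faithfully flat, hence injective.
[cite: Kato1994, Thm. (4.1)] -/
theorem isDomain_stalk_of_isLogRegularEtale (hK : Kato1994_logRegularLocal_isIntegrallyClosed.{0})
    {Y : Scheme.{0}} (hY : Scheme.IsLogRegularEtale Y) (y : Y) :
    IsDomain (Y.presheaf.stalk y) := by
  obtain ⟨𝒜, h𝒜⟩ := hY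
  haveI := h𝒜.isLocallyNoetherian
  obtain ⟨i, u, rfl⟩ := 𝒜.exists_eq y
  haveI : IsLocallyNoetherian (𝒜.U i) := LocallyOfFiniteType.isLocallyNoetherian (𝒜.map i)
  have hdom : IsDomain ((𝒜.U i).presheaf.stalk u) :=
    (hK _ (𝒜.rk i) (𝒜.P i) (𝒜.stalkChart i u) (𝒜.fg i) (𝒜.saturated i) (𝒜.span_eq_top i)
      (h𝒜.isLogRegularLocal i u)).1
  let φ : Y.presheaf.stalk (𝒜.map i u) →+* (𝒜.U i).presheaf.stalk u := ((𝒜.map i).stalkMap u).hom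
  have hflat : φ.Flat := Flat.stalkMap (𝒜.map i) u
  letI := φ.toAlgebra
  haveI : Module.Flat (Y.presheaf.stalk (𝒜.map i u)) ((𝒜.U i).presheaf.stalk u) := hflat
  haveI : IsLocalHom (algebraMap (Y.presheaf.stalk (𝒜.map i u)) ((𝒜.U i).presheaf.stalk u)) :=
    inferInstanceAs (IsLocalHom φ)
  haveI : Module.FaithfullyFlat (Y.presheaf.stalk (𝒜.map i u)) ((𝒜.U i).presheaf.stalk u) :=
    Module.FaithfullyFlat.of_flat_of_isLocalHom
  have hinj : Function.Injective φ :=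
    FaithfulSMul.algebraMap_injective (Y.presheaf.stalk (𝒜.map i u)) ((𝒜.U i).presheaf.stalk u)
  exact Function.Injective.isDomain φ hinj


/-- **No stalk of `Spec k[ε]` is a domain**: `ε/1` is a non-zero nilpotent of every localization
of the dual numbers (an `s ∉ 𝔭` with `s·ε = 0` would lie in `𝔭`). [folklore] -/
theorem not_isDomain_stalk_spec_dualNumber (k : Type) [Field k]
    (x : ↥(Spec (CommRingCat.of (DualNumber k)))) :
    ¬ IsDomain ((Spec (CommRingCat.of (DualNumber k))).presheaf.stalk x) := by
  intro h
  haveI : IsDomain (Localization.AtPrime x.asIdeal) :=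
    Function.Injective.isDomain (Spec.stalkIso (.of (DualNumber k)) x).commRingCatIsoToRingEquiv.symm
      (Spec.stalkIso (.of (DualNumber k)) x).commRingCatIsoToRingEquiv.symm.injective
  have hε : algebraMap (DualNumber k) (Localization.AtPrime x.asIdeal) DualNumber.eps = 0 := by
    have h2 : (algebraMap (DualNumber k) (Localization.AtPrime x.asIdeal) DualNumber.eps) ^ 2 = 0 := by
      rw [← map_pow, pow_two, DualNumber.eps_mul_eps, map_zero]
    exact (pow_eq_zero_iff two_ne_zero).mp h2
  obtain ⟨⟨s, hs⟩, hsε⟩ :=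
    (IsLocalization.map_eq_zero_iff x.asIdeal.primeCompl (Localization.AtPrime x.asIdeal) _).mp hε
  exact (Ideal.mem_primeCompl_iff.mp hs) (DualNumber.mem_of_mul_eps_eq_zero x.asIdeal hsε)

/-- P1 `BoundaryLogRegularization` with the hypothesis `IsIntegral X` DELETED, everything else
verbatim. [folklore] -/
def BoundaryLogRegularizationWithoutIsIntegral : Prop :=
  ∀ p : ℕ, p.Prime → ∀ (k : Type) [Field k] [CharP k p] [PerfectField k] (n : ℕ)
        (X : AlgebraicGeometry.Scheme.{0})
        (f : X ⟶ (Literature.AlgebraicGeometry.Motives.projectiveSpace n k).left),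
        AlgebraicGeometry.IsFinite f → Function.Surjective f.base →
        (letI := MvPolynomial.gradedAlgebra (σ := Fin (n + 1)) (R := k);
          AlgebraicGeometry.Etale (f ∣_ (AlgebraicGeometry.Proj.basicOpen
            (MvPolynomial.homogeneousSubmodule (Fin (n + 1)) k) (MvPolynomial.X (Fin.last n))))) →
        ∀ h : (Literature.AlgebraicGeometry.Motives.projectiveSpace n k).left,
        (letI := MvPolynomial.gradedAlgebra (σ := Fin (n + 1)) (R := k);
          h ∉ AlgebraicGeometry.Proj.basicOpen (MvPolynomial.homogeneousSubmodule (Fin (n + 1)) k)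
            (MvPolynomial.X (Fin.last n))) →
        ∃ B : (Literature.AlgebraicGeometry.Motives.projectiveSpace n k).left.Opens, h ∈ B ∧
          ∃ (Y : AlgebraicGeometry.Scheme.{0})
            (π : Y ⟶ ((f ⁻¹ᵁ B : X.Opens) : AlgebraicGeometry.Scheme.{0})),
            AlgebraicGeometry.IsProper π ∧ Literature.AlgebraicGeometry.Resolution.IsBirational π ∧
              Literature.AlgebraicGeometry.Resolution.Scheme.IsLogRegularEtale Y

/-- **`IsIntegral X` is load-bearing in `BoundaryLogRegularization` (P1), modulo Kato 1994 (4.1).**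
With the integrality hypothesis deleted, the stub / child P1 of the split of `CoverResolution` is
FALSE, granted the named fact `Kato1994_logRegularLocal_isIntegrallyClosed` (log regular local
rings are domains). Witness (that of `coverResolution_false_without_isIntegral`): `p = 2`, `k = 𝔽₂`,
`n = 1`, `X = ℙ¹_k ⨿ Spec k[ε]`, `f = 𝟙 ⨿ [1:0]` (finite, surjective, an open immersion over
`D₊(x₁)`), `h = [1:0] ∈ V₊(x₁)`. For ANY open `B ∋ h` and any proper birational `π : Y → f⁻¹(B)`:
the summand `Spec k[ε]` is OPEN in `X` and lies in `f⁻¹(B)`, so the dense open over which `π` is an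
isomorphism contains one of its points `x₁`; the stalk of `Y` at the point over `x₁` is then
isomorphic to a localization of `k[ε]`, not a domain — whereas every stalk of a log regular `Y` is
a domain (`isDomain_stalk_of_isLogRegularEtale`). So any proof of P1 uses reducedness of `X` over
`H`, exactly as for the crux. [cite: Kato1994, Thm. (4.1)] -/
theorem boundaryLogRegularization_false_without_isIntegral_of_kato1994
    (hK : Kato1994_logRegularLocal_isIntegrallyClosed.{0}) :
    ¬ BoundaryLogRegularizationWithoutIsIntegral := by
  intro H
  letI := MvPolynomial.gradedAlgebra (σ := Fin (1 + 1)) (R := ZMod 2)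
  let P : Scheme.{0} := (projectiveSpace 1 (ZMod 2)).left
  let T : Scheme.{0} := Spec (.of (DualNumber (ZMod 2)))
  let z : Fin (1 + 1) → ZMod 2 := Pi.single 0 1
  have hz : z ≠ 0 := by
    intro h0; have := congrFun h0 0; simp [z] at this
  let Pv := ProjectiveSpace.pointOfVec (n := 1) (ZMod 2) z hz
  let φ : T ⟶ (specOver (ZMod 2) (ZMod 2)).left :=
    Spec.map (CommRingCat.ofHom (algebraMap (ZMod 2) (DualNumber (ZMod 2))))
  let g : T ⟶ P := φ ≫ Pv.left
  let W : P.Opens :=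
    Proj.basicOpen (MvPolynomial.homogeneousSubmodule (Fin (1 + 1)) (ZMod 2)) (MvPolynomial.X (Fin.last 1))
  have hPvW : Pv.pt ∉ W := by
    show Pv.pt ∉ Proj.basicOpen _ (MvPolynomial.X (Fin.last 1))
    rw [ProjectiveSpace.pt_pointOfVec_mem_basicOpen_X_iff z hz (Fin.last 1)]
    simp [z]
  have hgpt : ∀ t : T, g.base t = Pv.pt := by
    intro t
    show Pv.left.base (φ.base t) = Pv.left.base (IsLocalRing.closedPoint (ZMod 2))
    haveI : Subsingleton ↥(specOver (ZMod 2) (ZMod 2)).left :=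
      inferInstanceAs (Subsingleton (PrimeSpectrum (ZMod 2)))
    rw [Subsingleton.elim (φ.base t) (IsLocalRing.closedPoint (ZMod 2))]
  have hg : ∀ t : T, g.base t ∉ W := fun t => by rw [hgpt t]; exact hPvW
  let X : Scheme.{0} := P ⨿ T
  let f : X ⟶ P := coprod.desc (𝟙 P) g
  -- `f` is finite
  haveI : IsFinite φ := by
    haveI : Module.Finite (ZMod 2) (DualNumber (ZMod 2)) :=
      inferInstanceAs (Module.Finite (ZMod 2) (ZMod 2 × ZMod 2))
    show IsFinite (Spec.map _)
    rw [IsFinite.SpecMap_iff]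
    exact RingHom.finite_algebraMap.mpr inferInstance
  haveI : IsClosedImmersion Pv.left := isClosedImmersion_left_of_algPoints (ZMod 2) 1 Pv
  haveI : IsFinite g := MorphismProperty.comp_mem @IsFinite φ Pv.left ‹IsFinite φ› inferInstance
  haveI hfin : IsFinite f := inferInstance
  -- `f` is surjective (the identity summand)
  have hsurj : Function.Surjective f.base := by
    intro y
    refine ⟨(coprod.inl : P ⟶ X).base y, ?_⟩
    show ((coprod.inl : P ⟶ X) ≫ f).base y = y
    simp only [f, coprod.inl_desc]
    rfl
  -- `f` is an open immersion (hence étale) over the chart `W = D₊(x₁)`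
  have hfinr : ∀ t : T, f.base ((coprod.inr : T ⟶ X).base t) = g.base t := by
    intro t
    show ((coprod.inr : T ⟶ X) ≫ f).base t = g.base t
    simp only [f, coprod.inr_desc]
  have hrange : Set.range (f ⁻¹ᵁ W).ι.base ⊆ Set.range (coprod.inl : P ⟶ X).base := by
    rintro _ ⟨x, rfl⟩
    obtain ⟨y | t, hy⟩ := (coprodMk P T).surjective x.1
    · refine ⟨y, ?_⟩
      rw [← coprodMk_inl]
      exact hy
    · exfalso
      have hx : f.base x.1 ∈ W := x.2
      rw [← hy, coprodMk_inr] at hx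
      apply hg t
      rw [← hfinr t]
      exact hx
  let l := IsOpenImmersion.lift (coprod.inl : P ⟶ X) (f ⁻¹ᵁ W).ι hrange
  have hl : l ≫ coprod.inl = (f ⁻¹ᵁ W).ι := IsOpenImmersion.lift_fac _ _ hrange
  haveI : IsOpenImmersion l := by
    haveI : IsOpenImmersion (l ≫ (coprod.inl : P ⟶ X)) := by rw [hl]; infer_instance
    exact IsOpenImmersion.of_comp l (coprod.inl : P ⟶ X)
  have hfW : (f ∣_ W) ≫ W.ι = l := by
    rw [morphismRestrict_ι, ← hl, Category.assoc]
    simp only [f, coprod.inl_desc, Category.comp_id]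
  haveI : IsOpenImmersion (f ∣_ W) := by
    haveI : IsOpenImmersion ((f ∣_ W) ≫ W.ι) := by rw [hfW]; infer_instance
    exact IsOpenImmersion.of_comp (f ∣_ W) W.ι
  have het : Etale (f ∣_ W) := inferInstance
  -- apply P1-without-integrality at `h = [1:0]`
  obtain ⟨B, hhB, Y, π, hπ, hbir, hY⟩ := H 2 Nat.prime_two (ZMod 2) 1 X f hfin hsurj het Pv.pt hPvW
  haveI := hπ
  -- the fat summand lies in `V = f⁻¹ B` and is open there; the dense open of `π` meets it
  let V : X.Opens := f ⁻¹ᵁ B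
  obtain ⟨U, hUd, -, hUiso⟩ := hbir
  haveI := hUiso
  obtain ⟨t₀⟩ : Nonempty ↥T := inferInstanceAs (Nonempty (PrimeSpectrum (DualNumber (ZMod 2))))
  have hxtB : (coprod.inr : T ⟶ X).base t₀ ∈ V := by
    show f.base ((coprod.inr : T ⟶ X).base t₀) ∈ B
    rw [hfinr t₀, hgpt t₀]
    exact hhB
  have hSopen : IsOpen (V.ι.base ⁻¹' Set.range (coprod.inr : T ⟶ X).base) :=
    (coprod.inr : T ⟶ X).isOpenEmbedding.isOpen_range.preimage V.ι.continuous
  have hSne : (V.ι.base ⁻¹' Set.range (coprod.inr : T ⟶ X).base).Nonempty :=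
    ⟨⟨_, hxtB⟩, t₀, rfl⟩
  obtain ⟨x₁, hx₁S, hx₁U⟩ := hUd.inter_open_nonempty _ hSopen hSne
  obtain ⟨t₁, ht₁⟩ := hx₁S
  -- the point `y` of `Y` over `x₁`, where `π.stalkMap` is an isomorphism
  let e := asIso (π ∣_ U)
  let zz : ↥(π ⁻¹ᵁ U) := e.inv.base ⟨x₁, hx₁U⟩
  let y : Y := zz.1
  have hπy : π.base y = x₁ := by
    have h1 : (π ∣_ U).base zz = ⟨x₁, hx₁U⟩ := by
      show (e.inv ≫ e.hom).base ⟨x₁, hx₁U⟩ = ⟨x₁, hx₁U⟩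
      rw [e.inv_hom_id]; rfl
    have h2 := morphismRestrict_base_coe π U zz
    rw [h1] at h2
    exact h2.symm
  have hisoπ : IsIso (π.stalkMap y) :=
    ((MorphismProperty.isomorphisms CommRingCat).arrow_mk_iso_iff
      (morphismRestrictStalkMap π U zz)).mp (show IsIso ((π ∣_ U).stalkMap zz) from inferInstance)
  -- stalks: `𝒪_{Y,y}` is a domain (Kato), hence so are `𝒪_{V,x₁} ≅ 𝒪_{X,inr t₁} ≅ 𝒪_{T,t₁}`
  have hdomY : IsDomain (Y.presheaf.stalk y) := isDomain_stalk_of_isLogRegularEtale hK hY y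
  have hdomV : IsDomain ((V : Scheme.{0}).presheaf.stalk x₁) := by
    have h1 : IsDomain ((V : Scheme.{0}).presheaf.stalk (π.base y)) :=
      Function.Injective.isDomain (π.stalkMap y).hom
        (asIso (π.stalkMap y)).commRingCatIsoToRingEquiv.injective
    rwa [hπy] at h1
  have hdomX : IsDomain (X.presheaf.stalk (V.ι.base x₁)) :=
    Function.Injective.isDomain (V.ι.stalkMap x₁).hom
      (asIso (V.ι.stalkMap x₁)).commRingCatIsoToRingEquiv.injective
  rw [← ht₁] at hdomX
  have hdomT : IsDomain (T.presheaf.stalk t₁) :=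
    Function.Injective.isDomain (asIso ((coprod.inr : T ⟶ X).stalkMap t₁)).commRingCatIsoToRingEquiv.symm
      (asIso ((coprod.inr : T ⟶ X).stalkMap t₁)).commRingCatIsoToRingEquiv.symm.injective
  exact not_isDomain_stalk_spec_dualNumber (ZMod 2) t₁ hdomT

end Summit.ResolutionOfSingularities.ResolutionOfSingularities.Cruxes.CoverResolution.Disproof

end
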